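import Literature.NumberTheory.Automorphic.ArchEndoscopicCentralDescentRegular   -- ★ (3D) p841544: the ZERO descent under the `G`-regular invariant (brings ★ p841432 §1–§3 and ★ p841213, the rank-one engine)
import HarnessLib

/-!
# The DESCENT TO THE CENTRE WITH VALUES on `∏_w U(½,−½)_w`: if the symmetrised mixed orbital integrals of a test function `Θ` are read by a closed form `Ψ(S, u)` whose one-place
# central-curve derivatives descend with Harish-Chandra's constants, then `Θ` AT THE CENTRE is `Ψ(∅)` (Rogawski 1990 §8.2 pp. 118–119, §14.5 Lemma 14.5.2 (b)(c) p. 238; Varadarajan 1989 §6.4 Thm 22)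

Topic `NumberTheory/Automorphic`; namespace `Literature.NumberTheory.Automorphic.UnitaryGroup`.  THEOREMS ONLY (no `def`, no instance, no notation, no axiom, no named fact, no `sorry`).
Cell `pub/hodgecm-mathlib`, HCML Track B «K2-LIT», ENGINE E4 unit U6 `ArchLimitConstant` (crux H413 = `stmt-HodgeConjecture-24833`), sockets #9 `sig_K2E4ExplicitArchSingularTransfer`,
#11 `sig_K2E4ArchSingularKernel`, #13 `sig_K2E4ArchTransferValueNonvanishing` of `Cruxes/H413/Lines/K2_E4_SingularTransferKappaSignSigsArchLimitConstant.lean`; author K2E4-p13 (g0), 2026-09-03.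

WHY.  ★ p841432 §2∕§3 (`sum_integral_pi_erase_eq_zero_of_eventuallyEq`, `apply_center_eq_zero_of_forall_sum_integral_pi_eq_zero`) and ★ p841544 (`…_of_ne_center`) descend to the centre with
LIMIT ZERO at every step — the (S-c) case [Lemma 14.5.2 (c)], where the `G′`-side of (4.3.1) is flat along the central curve at a definite place.  Prop. 8.2.1 (a) at `∞` and Lemma 14.5.2 (b)
(the κ-singular transfer at the SEMIREGULAR rational points `γ_H ⊗ 1 = ((e₁•1₂) ⊗ 1, e₂ ⊗ 1)`, `e₁ ≠ e₂`: `H`-central at EVERY complex place, `G`-semiregular) need the same descent WITH VALUES: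
at each place the `G′`-side has a NON-ZERO derivative limit across the `H`-wall (★ (J-nc) `archLimitFormulaNoncompactWall_holds`, ★ `ArchTorusOrbitalCompactWall*`), and the value
`aH(γ_H ⊗ 1)` is the product of the per-place data divided by Harish-Chandra's constants.  This file is that bookkeeping, over the SAME engine ★ p841213
`exists_tendsto_deriv_two_sin_smul_integral_integral_insert` (ONE constant `C_w ≠ 0` per place, independent of the other-place measures, of `Θ` and of the central angle).

THE DATA are those of ★ p841432 VERBATIM (lambdas, no definitions): `G_w = archLocal L 2 (diag α) w` (`α_i ≠ 0`, `σ_wα` real of opposite signs), Haar `νw w`, central angles `z : W → S¹`,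
torus data `u : W → Fin 2 → S¹`, flips `ε : W → Bool`, the measure family `M(S, u, ε)` (orbit measures on `S`, Dirac masses at `diag(z_w, z_w)` off `S`) and the symmetrised mixed orbital
integral `I(S, u) = Σ_ε ∫ Θ ↑↑e⁻¹(o) d(⊗_w M(S, u, ε)_w)(o)`.

WHAT IS PROVED.
§1 (generic calculus, `E`-valued) `smul_eq_of_tendsto_deriv_of_eventuallyEq` (`∂F → C • V`, `∂r → ℓ`, `F = r` near `0` ⇒ `C • V = ℓ`) and
   `smul_finset_sum_eq_of_tendsto_deriv_sub_comp_neg` (`(2C) • Σ_j V_j = ℓ` for the symmetrised sums of ★ p841213 §3) — the value twins of ★ `smul_eq_zero_of_tendsto_deriv_of_eventuallyEq` ∕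
   ★ `finset_sum_eq_zero_of_tendsto_deriv_sub_comp_neg`.
§2 **`exists_const_sum_integral_pi_erase_eq_inv_smul`** — ONE DESCENT STEP WITH VALUE: at a place `w₁` there is `C ≠ 0` (the engine's constant at `(L, α, w₁, νw w₁)`) such that for every
   `Θ`, `S ∋ w₁`, `u` regular on `S ∖ w₁` and every `r` differentiable on `𝓝[≠] 0` with `∂r → ℓ` agreeing there with `ψ ↦ 2 sin ψ • I(S, u[w₁ ↦ (z e^{iψ}, z e^{−iψ})])`:
   `I(S ∖ w₁, u) = C⁻¹ • ℓ` (same proof as ★ §2, the last line through §1).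
§3 **`exists_const_sum_integral_pi_eq_of_closedForm`** — THE DESCENT WITH VALUES under the `G`-regular invariant of ★ p841544: there are constants `C : W → ℝ`, `C_w ≠ 0`, such that for
   every `Θ`, `S₀` and every CLOSED FORM `Ψ : Finset W → (W → Fin 2 → S¹) → E` with (top) `I(S₀, u) = Ψ(S₀, u)` at every `u` `G`-regular on `S₀` and (step) for `S ⊆ S₀`, `w₁ ∈ S`, `u`
   `G`-regular on `S ∖ w₁`: `ψ ↦ 2 sin ψ • Ψ(S, u[w₁ ↦ (z e^{iψ}, z e^{−iψ})])` differentiable on `𝓝[≠] 0` with derivative `→ C_{w₁} • Ψ(S ∖ w₁, u)` — one has `I(S₀ ∖ T, u) = Ψ(S₀ ∖ T, u)` for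
   every `T` and every `u` `G`-regular on `S₀ ∖ T`; **`sum_integral_pi_empty_eq_card_smul_apply_center`** — `I(∅, u) = 2^{|W|} • Θ(centre)`; hence
   **`exists_const_card_smul_apply_center_eq_of_closedForm`** — `2^{|W|} • Θ(centre) = Ψ(∅, u)`.
§4 (ED. 2) **`exists_const_sum_integral_pi_eq_of_closedForm_of_reg`** ∕ **`exists_const_card_smul_apply_center_eq_of_closedForm_of_reg`** — the same descent under a GENERAL per-place
   regularity predicate `Reg_w` (holding along the central curve near `ψ = 0`): the SEMIREGULAR centres of U6 have central 2-block angle `σ_w e₁` but must avoid the frozen `U(Φ₁)`-angle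
   `σ_w e₂ ≠ σ_w e₁` for `G`-regularity (`Reg_w v :⇔ v 0 ≠ v 1 ∧ v i ≠ σ_w e₂`, ★ `eventually_nhdsWithin_curve_ne_and_ne`), which §3's (S-c)-shaped invariant `u_w i ≠ z_w` does not express.
§5 (ED. 3) **`exists_const_tendsto_deriv_two_sin_smul_sum_integral_pi`** ∕ **`exists_const_forall_tendsto_deriv_two_sin_smul_sum_integral_pi`** — the H-family's OWN one-step law,
   `r`-free: `∂_ψ[2 sin ψ • I(S, u[w₁ ↦ z e^{±iψ}])] → C_{w₁} • I(S ∖ w₁, u)` on `𝓝[≠] 0` (+ differentiability on `0 < |ψ| < 1`) — the `hstep` of the joint place-induction engine ★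
   `K2E4ArchSingularKernelPlaceInduction.eq_of_step_of_regular_eq` (K2E4-p11) in the assembler's (K2E4-p09) currency.
USE (U6): with `Θ = Θ₂` the 2-block test function of the `Δ‴_∞`-transfer `aH` (★ `ArchSmooth₂.exists_contDiff_twoBlock`), `S₀ = univ`, (top) = (vi) in Haar currency (★ (β)
`sum_integral_pi_eq_inv_mul_finsum_delta_comap_archSingularCurve` ∕ ★ `ArchDeltaTransferHaarForm`) and `Ψ(S, u) = κ⁻¹ · (∏_{w ∉ S} C_w⁻¹ J_w) · (G′-side at the places of S)` for a pure-tensor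
`a′`, §3 reads `aH(γ_H ⊗ 1) = 2^{−|W|} κ⁻¹ ∏_w C_w⁻¹ J_w(a′)` — #9's `cinf`, #11's kernel and #13's non-vanishing at once.
HONEST LABEL: HC_CM is proved only modulo the 7 printed citations (2 remaining named inputs: hLiu418 = stmt-HodgeConjecture-24832, h413 = stmt-HodgeConjecture-24833) until rung 0 closes;
this file is real-analysis ∕ measure bookkeeping over ★ p841213 ∕ p841432 ∕ p841544 and pays no printed citation by itself.

## References
* [Rogawski1990] J. D. Rogawski, *Automorphic Representations of Unitary Groups in Three Variables*, Ann. of Math. Stud. 123 (1990), §8.2 Prop. 8.2.1 pp. 118–119; §14.5 Lemma 14.5.2 (b)(c)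
  p. 238; §8.4 pp. 126–127.
* [Varadarajan1989] V. S. Varadarajan, *An Introduction to Harmonic Analysis on Semisimple Lie Groups* (1989), §6.4 Thm. 22.
* [BorelJacquet1979] A. Borel, H. Jacquet, *Automorphic forms and automorphic representations*, PSPM 33.1 (1979), §4.1.
-/

set_option autoImplicit false

noncomputable section

open MeasureTheory Matrix NumberField NumberField.InfinitePlace NumberField.mixedEmbedding Set Function Filter Topology
open scoped MatrixGroups ContDiff Real
open scoped Matrix.Norms.Operator

namespace Literature.NumberTheory.Automorphic.UnitaryGroup

/-! ## §1 The calculus of the descent, with values -/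

section Calculus

variable {E : Type*} [NormedAddCommGroup E] [NormedSpace ℝ E]

/-- **One descent step, value form**: if `∂F → C • V` along `𝓝[≠] 0`, and `F` agrees near `0` (`ψ ≠ 0`) with a function `r` whose derivative tends to `ℓ` there, then `C • V = ℓ`
(value twin of ★ `smul_eq_zero_of_tendsto_deriv_of_eventuallyEq`). [cite: Rogawski1990, §8.2 Prop. 8.2.1 p. 119] [cite: Varadarajan1989, §6.4 Thm. 22] -/
theorem smul_eq_of_tendsto_deriv_of_eventuallyEq {F r : ℝ → E} {C : ℝ} {V ℓ : E}
    (hF : Tendsto (fun ψ : ℝ => deriv F ψ) (𝓝[≠] 0) (𝓝 (C • V)))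
    (hr : Tendsto (fun ψ : ℝ => deriv r ψ) (𝓝[≠] 0) (𝓝 ℓ)) (hFr : F =ᶠ[𝓝[≠] (0 : ℝ)] r) : C • V = ℓ := by
  have h1 : Tendsto (fun ψ : ℝ => deriv F ψ) (𝓝[≠] 0) (𝓝 ℓ) :=
    (Filter.tendsto_congr' (deriv_congr_of_eventuallyEq_nhdsWithin_ne hFr)).2 hr
  exact tendsto_nhds_unique hF h1

/-- The same with the conclusion on a finite symmetrised sum (the shape produced by ★ `tendsto_deriv_finset_sum_sub_comp_neg`): `(2C) • Σ_j V_j = ℓ`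
(value twin of ★ `finset_sum_eq_zero_of_tendsto_deriv_sub_comp_neg`). [cite: Rogawski1990, §8.2 Prop. 8.2.1 p. 119] [cite: Varadarajan1989, §6.4 Thm. 22] -/
theorem smul_finset_sum_eq_of_tendsto_deriv_sub_comp_neg {ι : Type*} (s : Finset ι) (g : ι → ℝ → E) (V : ι → E) (C : ℝ)
    (hd : ∀ j ∈ s, ∀ ψ ∈ Ioo (-1 : ℝ) 1, ψ ≠ 0 → DifferentiableAt ℝ (g j) ψ)
    (hlim : ∀ j ∈ s, Tendsto (fun ψ : ℝ => deriv (g j) ψ) (𝓝[≠] 0) (𝓝 (C • V j)))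
    (r : ℝ → E) {ℓ : E} (hr : Tendsto (fun ψ : ℝ => deriv r ψ) (𝓝[≠] 0) (𝓝 ℓ))
    (hFr : (fun ψ : ℝ => ∑ j ∈ s, (g j ψ - g j (-ψ))) =ᶠ[𝓝[≠] (0 : ℝ)] r) :
    (2 * C) • ∑ j ∈ s, V j = ℓ := by
  have h := tendsto_deriv_finset_sum_sub_comp_neg s g (fun j => C • V j) hd hlim
  rw [← Finset.smul_sum] at h
  refine smul_eq_of_tendsto_deriv_of_eventuallyEq (V := ∑ j ∈ s, V j) ?_ hr hFr
  rw [mul_smul]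
  exact h

end Calculus

/-! ## §2 One descent step with value: `w₁` leaves `S` -/

section Step

variable (L : Type) [Field L] [NumberField L] [IsCMField L] (α : Fin 2 → L)
  [∀ w : {w : InfinitePlace L // IsComplex w}, MeasurableSpace (archLocal L 2 (Matrix.diagonal α) w)]
  [∀ w : {w : InfinitePlace L // IsComplex w}, BorelSpace (archLocal L 2 (Matrix.diagonal α) w)]
  (νw : ∀ w : {w : InfinitePlace L // IsComplex w}, Measure (archLocal L 2 (Matrix.diagonal α) w)) [∀ w, (νw w).IsHaarMeasure]
  (z : {w : InfinitePlace L // IsComplex w} → Circle)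

open scoped Classical in
/-- **ONE DESCENT STEP WITH VALUE.**  At a complex place `w₁` (`σ_{w₁}α` real of opposite signs) there is ONE constant `C ≠ 0` — Harish-Chandra's constant of ★
`exists_tendsto_deriv_two_sin_smul_integral_integral_insert` at `(L, α, w₁, νw w₁)` — such that: for every smooth `Θ` with `g ↦ Θ ↑↑g` compactly supported, every `S ∋ w₁`, every `u` regular
on `S ∖ w₁`, and every `r` differentiable on `𝓝[≠] 0` with `∂r → ℓ` that agrees there with `ψ ↦ 2 sin ψ • Σ_ε ∫ Θ d(⊗ M(S, u[w₁ ↦ (z e^{iψ}, z e^{−iψ})], ε))`, one has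
`Σ_ε ∫ Θ d(⊗ M(S ∖ w₁, u, ε)) = C⁻¹ • ℓ`.  (★ p841432 §2 is the case `ℓ = 0`; same mechanism: the flip at `w₁` is `ψ ↦ −ψ`, ★ `ArchPiMeasureInsert` moves `w₁` in and out, the
engine gives `∂g_ε → C • V_ε` with ONE `C`, and §1 concludes.) [cite: Rogawski1990, §8.2 Prop. 8.2.1 pp. 118–119; §14.5 Lemma 14.5.2 (b) p. 238] [cite: Varadarajan1989, §6.4 Thm. 22] -/
theorem exists_const_sum_integral_pi_erase_eq_inv_smul {E : Type*} [NormedAddCommGroup E] [NormedSpace ℝ E] [CompleteSpace E]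
    (hα : ∀ i, α i ≠ 0) (w₁ : {w : InfinitePlace L // IsComplex w})
    (hreal : ∀ i, (w₁.1.embedding (α i)).im = 0) (hsgn : (w₁.1.embedding (α 0)).re * (w₁.1.embedding (α 1)).re < 0) :
    ∃ C : ℝ, C ≠ 0 ∧
      ∀ (Θ : Matrix (Fin 2) (Fin 2) (mixedSpace L) → E), ContDiff ℝ (⊤ : ℕ∞) Θ →
        HasCompactSupport (fun g : arch (↥(maximalRealSubfield L)) L (IsCMField.complexConj L) 2 (Matrix.diagonal α) =>
          Θ ((g : GL (Fin 2) (mixedSpace L)) : Matrix (Fin 2) (Fin 2) (mixedSpace L))) →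
        ∀ (S : Finset {w : InfinitePlace L // IsComplex w}), w₁ ∈ S →
        ∀ (u : {w : InfinitePlace L // IsComplex w} → Fin 2 → Circle), (∀ w ∈ S, w ≠ w₁ → u w 0 ≠ u w 1) →
        ∀ (r : ℝ → E) (ℓ : E), (∀ᶠ ψ in 𝓝[≠] (0 : ℝ), DifferentiableAt ℝ r ψ) → Tendsto (fun ψ : ℝ => deriv r ψ) (𝓝[≠] 0) (𝓝 ℓ) →
        (∀ᶠ ψ in 𝓝[≠] (0 : ℝ), (2 * Real.sin ψ) • ∑ ε : {w : InfinitePlace L // IsComplex w} → Bool,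
          ∫ o, Θ (((((archPiEquivCM 2 L (Matrix.diagonal α)).symm o) : arch (↥(maximalRealSubfield L)) L (IsCMField.complexConj L) 2 (Matrix.diagonal α)) : GL (Fin 2) (mixedSpace L)) : Matrix (Fin 2) (Fin 2) (mixedSpace L))
              ∂(Measure.pi (fun w : {w : InfinitePlace L // IsComplex w} =>
              if w ∈ S then (νw w).map (fun g : archLocal L 2 (Matrix.diagonal α) w =>
                g * ⟨circleDiagonal 2 (if ε w then (Function.update u w₁ ![z w₁ * Circle.exp ψ, z w₁ * Circle.exp (-ψ)]) w ∘ ⇑(Equiv.swap (0 : Fin 2) 1) else (Function.update u w₁ ![z w₁ * Circle.exp ψ, z w₁ * Circle.exp (-ψ)]) w), circleDiagonal_mem_archLocal_diagonal L 2 α w _⟩ * g⁻¹)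
              else Measure.dirac (⟨circleDiagonal 2 ![z w, z w], circleDiagonal_mem_archLocal_diagonal L 2 α w _⟩ : archLocal L 2 (Matrix.diagonal α) w))) = r ψ) →
        ∑ ε : {w : InfinitePlace L // IsComplex w} → Bool,
          ∫ o, Θ (((((archPiEquivCM 2 L (Matrix.diagonal α)).symm o) : arch (↥(maximalRealSubfield L)) L (IsCMField.complexConj L) 2 (Matrix.diagonal α)) : GL (Fin 2) (mixedSpace L)) : Matrix (Fin 2) (Fin 2) (mixedSpace L))
              ∂(Measure.pi (fun w : {w : InfinitePlace L // IsComplex w} =>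
              if w ∈ S.erase w₁ then (νw w).map (fun g : archLocal L 2 (Matrix.diagonal α) w =>
                g * ⟨circleDiagonal 2 (if ε w then u w ∘ ⇑(Equiv.swap (0 : Fin 2) 1) else u w), circleDiagonal_mem_archLocal_diagonal L 2 α w _⟩ * g⁻¹)
              else Measure.dirac (⟨circleDiagonal 2 ![z w, z w], circleDiagonal_mem_archLocal_diagonal L 2 α w _⟩ : archLocal L 2 (Matrix.diagonal α) w))) = C⁻¹ • ℓ := by
  haveI : ∀ w : {w : InfinitePlace L // IsComplex w}, SecondCountableTopology (archLocal L 2 (Matrix.diagonal α) w) := fun w => secondCountableTopology_archLocal L 2 (Matrix.diagonal α) w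
  haveI : ∀ w : {w : InfinitePlace L // IsComplex w}, LocallyCompactSpace (archLocal L 2 (Matrix.diagonal α) w) := fun w => locallyCompactSpace_archLocal L 2 (Matrix.diagonal α) w
  -- the engine at `w₁`: ONE constant for all other-place measures, all `Θ`, all `z`
  obtain ⟨C, hC, hlim⟩ := exists_tendsto_deriv_two_sin_smul_integral_integral_insert (E := E) L α hα w₁ hreal hsgn (νw w₁)
  refine ⟨C, hC, ?_⟩
  intro Θ hΘ hΘc S hw₁ u hu r ℓ hrd hr heq
  -- regularity of `u` on `S ∖ w₁`; the families `M(S ∖ w₁, u, ε)` are Radon and σ-finite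
  have hu' : ∀ w ∈ S.erase w₁, u w 0 ≠ u w 1 := fun w hw => hu w (Finset.mem_of_mem_erase hw) (Finset.ne_of_mem_erase hw)
  haveI hR : ∀ (ε : {w : InfinitePlace L // IsComplex w} → Bool) (w : {w : InfinitePlace L // IsComplex w}), IsFiniteMeasureOnCompacts ((fun w : {w : InfinitePlace L // IsComplex w} =>
          if w ∈ S.erase w₁ then (νw w).map (fun g : archLocal L 2 (Matrix.diagonal α) w =>
            g * ⟨circleDiagonal 2 (if ε w then u w ∘ ⇑(Equiv.swap (0 : Fin 2) 1) else u w), circleDiagonal_mem_archLocal_diagonal L 2 α w _⟩ * g⁻¹)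
          else Measure.dirac (⟨circleDiagonal 2 ![z w, z w], circleDiagonal_mem_archLocal_diagonal L 2 α w _⟩ : archLocal L 2 (Matrix.diagonal α) w)) w) :=
    fun ε w => isFiniteMeasureOnCompacts_measureFamily L α νw z hα _ u hu' ε w
  haveI hσ : ∀ (ε : {w : InfinitePlace L // IsComplex w} → Bool) (w : {w : InfinitePlace L // IsComplex w}), SigmaFinite ((fun w : {w : InfinitePlace L // IsComplex w} =>
          if w ∈ S.erase w₁ then (νw w).map (fun g : archLocal L 2 (Matrix.diagonal α) w =>
            g * ⟨circleDiagonal 2 (if ε w then u w ∘ ⇑(Equiv.swap (0 : Fin 2) 1) else u w), circleDiagonal_mem_archLocal_diagonal L 2 α w _⟩ * g⁻¹)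
          else Measure.dirac (⟨circleDiagonal 2 ![z w, z w], circleDiagonal_mem_archLocal_diagonal L 2 α w _⟩ : archLocal L 2 (Matrix.diagonal α) w)) w) :=
    fun ε w => sigmaFinite_measureFamily L α νw z hα _ u hu' ε w
  -- the test function on `∏_w G_w`
  set F : (∀ w : {w : InfinitePlace L // IsComplex w}, archLocal L 2 (Matrix.diagonal α) w) → E := fun o => Θ (((((archPiEquivCM 2 L (Matrix.diagonal α)).symm o) : arch (↥(maximalRealSubfield L)) L (IsCMField.complexConj L) 2 (Matrix.diagonal α)) : GL (Fin 2) (mixedSpace L)) : Matrix (Fin 2) (Fin 2) (mixedSpace L)) with hF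
  obtain ⟨hFc, hFs⟩ := continuous_hasCompactSupport_comp_archPiEquivCM_symm L α Θ hΘ.continuous hΘc
  have hFm : StronglyMeasurable F := hFc.stronglyMeasurable
  -- the other-place families, blind to `ε w₁`
  set μ' : ({w : InfinitePlace L // IsComplex w} → Bool) → ∀ w' : {w : {w : InfinitePlace L // IsComplex w} // ¬ w = w₁}, Measure (archLocal L 2 (Matrix.diagonal α) w'.1) :=
    fun ε w' => (fun w : {w : InfinitePlace L // IsComplex w} =>
          if w ∈ S.erase w₁ then (νw w).map (fun g : archLocal L 2 (Matrix.diagonal α) w =>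
            g * ⟨circleDiagonal 2 (if ε w then u w ∘ ⇑(Equiv.swap (0 : Fin 2) 1) else u w), circleDiagonal_mem_archLocal_diagonal L 2 α w _⟩ * g⁻¹)
          else Measure.dirac (⟨circleDiagonal 2 ![z w, z w], circleDiagonal_mem_archLocal_diagonal L 2 α w _⟩ : archLocal L 2 (Matrix.diagonal α) w)) w'.1 with hμ'
  haveI : ∀ ε w', IsFiniteMeasureOnCompacts (μ' ε w') := fun ε w' => hR ε w'.1
  haveI : ∀ ε w', SigmaFinite (μ' ε w') := fun ε w' => hσ ε w'.1
  have hμ'u : ∀ ε b, μ' (Function.update ε w₁ b) = μ' ε := by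
    intro ε b
    funext w'
    simp only [hμ', Function.update_of_ne w'.2]
  set g : ({w : InfinitePlace L // IsComplex w} → Bool) → ℝ → E := fun ε ψ => (2 * Real.sin ψ) •
    ∫ k : archLocal L 2 (Matrix.diagonal α) w₁, ∫ o : (∀ w' : {w : {w : InfinitePlace L // IsComplex w} // ¬ w = w₁}, archLocal L 2 (Matrix.diagonal α) w'.1),
      Θ (((((archPiEquivCM 2 L (Matrix.diagonal α)).symm ((MeasurableEquiv.piEquivPiSubtypeProd (fun w : {w : InfinitePlace L // IsComplex w} => ↥(archLocal L 2 (Matrix.diagonal α) w)) (· = w₁)).symm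
              ((MeasurableEquiv.piUnique fun i : {w : {w : InfinitePlace L // IsComplex w} // w = w₁} => ↥(archLocal L 2 (Matrix.diagonal α) i.1)).symm
                (k * ⟨circleDiagonal 2 ![z w₁ * Circle.exp ψ, z w₁ * Circle.exp (-ψ)], circleDiagonal_mem_archLocal_diagonal L 2 α w₁ _⟩ * k⁻¹), o))) : arch (↥(maximalRealSubfield L)) L (IsCMField.complexConj L) 2 (Matrix.diagonal α)) : GL (Fin 2) (mixedSpace L)) : Matrix (Fin 2) (Fin 2) (mixedSpace L))
      ∂(Measure.pi (μ' ε)) ∂(νw w₁) with hg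
  set V : ({w : InfinitePlace L // IsComplex w} → Bool) → E := fun ε =>
    ∫ o : (∀ w' : {w : {w : InfinitePlace L // IsComplex w} // ¬ w = w₁}, archLocal L 2 (Matrix.diagonal α) w'.1),
      Θ (((((archPiEquivCM 2 L (Matrix.diagonal α)).symm ((MeasurableEquiv.piEquivPiSubtypeProd (fun w : {w : InfinitePlace L // IsComplex w} => ↥(archLocal L 2 (Matrix.diagonal α) w)) (· = w₁)).symm
              ((MeasurableEquiv.piUnique fun i : {w : {w : InfinitePlace L // IsComplex w} // w = w₁} => ↥(archLocal L 2 (Matrix.diagonal α) i.1)).symm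
                ((⟨circleDiagonal 2 ![z w₁, z w₁], circleDiagonal_mem_archLocal_diagonal L 2 α w₁ _⟩ : archLocal L 2 (Matrix.diagonal α) w₁)), o))) : arch (↥(maximalRealSubfield L)) L (IsCMField.complexConj L) 2 (Matrix.diagonal α)) : GL (Fin 2) (mixedSpace L)) : Matrix (Fin 2) (Fin 2) (mixedSpace L))
      ∂(Measure.pi (μ' ε)) with hV
  have hgl : ∀ ε, Tendsto (fun ψ : ℝ => deriv (g ε) ψ) (𝓝[≠] 0) (𝓝 (C • V ε)) ∧
      ∀ ψ ∈ Ioo (-1 : ℝ) 1, ψ ≠ 0 → DifferentiableAt ℝ (g ε) ψ := fun ε => hlim (μ' ε) Θ hΘ hΘc (z w₁)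
  have hgu : ∀ ε b, g (Function.update ε w₁ b) = g ε := fun ε b => by simp only [hg, hμ'u]
  -- `V ε` is the Dirac-at-`w₁` integral over `M(S ∖ w₁, u, ε)`
  have hVint : ∀ ε, V ε = ∫ o, Θ (((((archPiEquivCM 2 L (Matrix.diagonal α)).symm o) : arch (↥(maximalRealSubfield L)) L (IsCMField.complexConj L) 2 (Matrix.diagonal α)) : GL (Fin 2) (mixedSpace L)) : Matrix (Fin 2) (Fin 2) (mixedSpace L))
          ∂(Measure.pi (fun w : {w : InfinitePlace L // IsComplex w} =>
          if w ∈ S.erase w₁ then (νw w).map (fun g : archLocal L 2 (Matrix.diagonal α) w =>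
            g * ⟨circleDiagonal 2 (if ε w then u w ∘ ⇑(Equiv.swap (0 : Fin 2) 1) else u w), circleDiagonal_mem_archLocal_diagonal L 2 α w _⟩ * g⁻¹)
          else Measure.dirac (⟨circleDiagonal 2 ![z w, z w], circleDiagonal_mem_archLocal_diagonal L 2 α w _⟩ : archLocal L 2 (Matrix.diagonal α) w))) := by
    intro ε
    have h1 : (∫ o, Θ (((((archPiEquivCM 2 L (Matrix.diagonal α)).symm o) : arch (↥(maximalRealSubfield L)) L (IsCMField.complexConj L) 2 (Matrix.diagonal α)) : GL (Fin 2) (mixedSpace L)) : Matrix (Fin 2) (Fin 2) (mixedSpace L))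
          ∂(Measure.pi (fun w : {w : InfinitePlace L // IsComplex w} =>
          if w ∈ S.erase w₁ then (νw w).map (fun g : archLocal L 2 (Matrix.diagonal α) w =>
            g * ⟨circleDiagonal 2 (if ε w then u w ∘ ⇑(Equiv.swap (0 : Fin 2) 1) else u w), circleDiagonal_mem_archLocal_diagonal L 2 α w _⟩ * g⁻¹)
          else Measure.dirac (⟨circleDiagonal 2 ![z w, z w], circleDiagonal_mem_archLocal_diagonal L 2 α w _⟩ : archLocal L 2 (Matrix.diagonal α) w)))) =
        ∫ o, F o ∂(Measure.pi (Function.update (fun w : {w : InfinitePlace L // IsComplex w} =>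
          if w ∈ S.erase w₁ then (νw w).map (fun g : archLocal L 2 (Matrix.diagonal α) w =>
            g * ⟨circleDiagonal 2 (if ε w then u w ∘ ⇑(Equiv.swap (0 : Fin 2) 1) else u w), circleDiagonal_mem_archLocal_diagonal L 2 α w _⟩ * g⁻¹)
          else Measure.dirac (⟨circleDiagonal 2 ![z w, z w], circleDiagonal_mem_archLocal_diagonal L 2 α w _⟩ : archLocal L 2 (Matrix.diagonal α) w)) w₁
          (Measure.dirac (⟨circleDiagonal 2 ![z w₁, z w₁], circleDiagonal_mem_archLocal_diagonal L 2 α w₁ _⟩ : archLocal L 2 (Matrix.diagonal α) w₁)))) := by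
      rw [← measureFamily_eq_update_dirac L α νw z (S.erase w₁) w₁ (Finset.notMem_erase w₁ S) u ε]
    rw [h1, integral_pi_update_dirac_archLocal L 2 α _ w₁ _ F (integrable_pi_update_of_hasCompactSupport _ w₁ _ F hFc hFs)]
  -- each term of the hypothesis, in the iterated currency: `2 sin ψ • ∫ Θ d(⊗ M(S, u_ψ, ε)) = g_ε(ψ)` or `−g_ε(−ψ)`
  have hI : ∀ ψ ∈ Ioo (-1 : ℝ) 1, ψ ≠ 0 → (2 * Real.sin ψ) • ∑ ε : {w : InfinitePlace L // IsComplex w} → Bool,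
      ∫ o, Θ (((((archPiEquivCM 2 L (Matrix.diagonal α)).symm o) : arch (↥(maximalRealSubfield L)) L (IsCMField.complexConj L) 2 (Matrix.diagonal α)) : GL (Fin 2) (mixedSpace L)) : Matrix (Fin 2) (Fin 2) (mixedSpace L))
          ∂(Measure.pi (fun w : {w : InfinitePlace L // IsComplex w} =>
          if w ∈ S then (νw w).map (fun g : archLocal L 2 (Matrix.diagonal α) w =>
            g * ⟨circleDiagonal 2 (if ε w then (Function.update u w₁ ![z w₁ * Circle.exp ψ, z w₁ * Circle.exp (-ψ)]) w ∘ ⇑(Equiv.swap (0 : Fin 2) 1) else (Function.update u w₁ ![z w₁ * Circle.exp ψ, z w₁ * Circle.exp (-ψ)]) w), circleDiagonal_mem_archLocal_diagonal L 2 α w _⟩ * g⁻¹)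
          else Measure.dirac (⟨circleDiagonal 2 ![z w, z w], circleDiagonal_mem_archLocal_diagonal L 2 α w _⟩ : archLocal L 2 (Matrix.diagonal α) w))) =
      ∑ ε : {w : InfinitePlace L // IsComplex w} → Bool, (if ε w₁ then -(g ε (-ψ)) else g ε ψ) := by
    intro ψ hψ hψ0
    rw [Finset.smul_sum]
    refine Finset.sum_congr rfl fun ε _ => ?_
    have hreg : z w₁ * Circle.exp ψ ≠ z w₁ * Circle.exp (-ψ) := mul_exp_ne_mul_exp_neg (z w₁) hψ hψ0
    have hinj : Function.Injective (if ε w₁ then ![z w₁ * Circle.exp ψ, z w₁ * Circle.exp (-ψ)] ∘ ⇑(Equiv.swap (0 : Fin 2) 1) else ![z w₁ * Circle.exp ψ, z w₁ * Circle.exp (-ψ)]) := by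
      split_ifs
      · exact injective_of_apply_zero_ne_apply_one _ (comp_swap_apply_zero_ne _ hreg)
      · exact injective_of_apply_zero_ne_apply_one _ hreg
    haveI := isFiniteMeasureOnCompacts_map_conj_circleDiagonal L 2 α w₁ hα _ hinj (νw w₁)
    haveI := sigmaFinite_map_conj_circleDiagonal L 2 α w₁ hα _ hinj (νw w₁)
    rw [measureFamily_update_eq_update L α νw z S w₁ hw₁ u _ ε,
      show (∫ o, Θ (((((archPiEquivCM 2 L (Matrix.diagonal α)).symm o) : arch (↥(maximalRealSubfield L)) L (IsCMField.complexConj L) 2 (Matrix.diagonal α)) : GL (Fin 2) (mixedSpace L)) : Matrix (Fin 2) (Fin 2) (mixedSpace L))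
        ∂(Measure.pi (Function.update (fun w : {w : InfinitePlace L // IsComplex w} =>
          if w ∈ S.erase w₁ then (νw w).map (fun g : archLocal L 2 (Matrix.diagonal α) w =>
            g * ⟨circleDiagonal 2 (if ε w then u w ∘ ⇑(Equiv.swap (0 : Fin 2) 1) else u w), circleDiagonal_mem_archLocal_diagonal L 2 α w _⟩ * g⁻¹)
          else Measure.dirac (⟨circleDiagonal 2 ![z w, z w], circleDiagonal_mem_archLocal_diagonal L 2 α w _⟩ : archLocal L 2 (Matrix.diagonal α) w)) w₁
          ((νw w₁).map (fun g : archLocal L 2 (Matrix.diagonal α) w₁ =>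
            g * ⟨circleDiagonal 2 (if ε w₁ then ![z w₁ * Circle.exp ψ, z w₁ * Circle.exp (-ψ)] ∘ ⇑(Equiv.swap (0 : Fin 2) 1) else ![z w₁ * Circle.exp ψ, z w₁ * Circle.exp (-ψ)]),
              circleDiagonal_mem_archLocal_diagonal L 2 α w₁ _⟩ * g⁻¹))))) = ∫ o, F o ∂_ from rfl,
      integral_pi_update_map_conj_circleDiagonal_archLocal L 2 α _ w₁ _ (νw w₁) F hFm
        (integrable_pi_update_of_hasCompactSupport _ w₁ _ F hFc hFs)]
    cases hb : ε w₁
    · simp only [Bool.false_eq_true, ↓reduceIte, hg, hF, hμ']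
    · simp only [↓reduceIte, hg, hF, hμ', comp_swap_eq, Real.sin_neg, mul_neg, neg_smul, neg_neg]
  -- the symmetrised sum is `2 • r` near `0`
  have hIoo : ∀ᶠ ψ : ℝ in 𝓝[≠] 0, ψ ∈ Ioo (-1 : ℝ) 1 ∧ ψ ≠ 0 :=
    Filter.inter_mem (mem_nhdsWithin_of_mem_nhds (Ioo_mem_nhds (by norm_num) (by norm_num))) self_mem_nhdsWithin
  have hFr : (fun ψ : ℝ => ∑ ε ∈ (Finset.univ : Finset ({w : InfinitePlace L // IsComplex w} → Bool)), (g ε ψ - g ε (-ψ))) =ᶠ[𝓝[≠] (0 : ℝ)] fun ψ => (2 : ℝ) • r ψ := by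
    filter_upwards [heq, hIoo] with ψ hψr hψ
    rw [← hψr, hI ψ hψ.1 hψ.2, two_smul_sum_ite_eq_sum_add w₁ (fun ε => -(g ε (-ψ))) (fun ε => g ε ψ)
      (fun ε b => by simp only [hgu]) (fun ε b => by simp only [hgu])]
    refine Finset.sum_congr rfl fun ε _ => ?_
    rw [sub_eq_add_neg, add_comm]
  have hr2 : Tendsto (fun ψ : ℝ => deriv (fun ψ : ℝ => (2 : ℝ) • r ψ) ψ) (𝓝[≠] 0) (𝓝 ((2 : ℝ) • ℓ)) := by
    have h : (fun ψ : ℝ => deriv (fun ψ : ℝ => (2 : ℝ) • r ψ) ψ) =ᶠ[𝓝[≠] (0 : ℝ)] fun ψ => (2 : ℝ) • deriv r ψ := by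
      filter_upwards [hrd] with ψ hψ
      exact deriv_const_smul (2 : ℝ) hψ
    rw [Filter.tendsto_congr' h]
    exact hr.const_smul (2 : ℝ)
  have hmain := smul_finset_sum_eq_of_tendsto_deriv_sub_comp_neg (Finset.univ : Finset ({w : InfinitePlace L // IsComplex w} → Bool)) g V C
    (fun ε _ => (hgl ε).2) (fun ε _ => (hgl ε).1) (fun ψ => (2 : ℝ) • r ψ) hr2 hFr
  rw [Finset.sum_congr rfl fun ε _ => hVint ε] at hmain
  -- `(2C) • I = 2 • ℓ` ⇒ `I = C⁻¹ • ℓ`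
  rw [mul_smul] at hmain
  have h2 := smul_right_injective E (two_ne_zero (α := ℝ)) hmain
  rw [← h2, smul_smul, inv_mul_cancel₀ hC, one_smul]

end Step

/-! ## §3 The descent to the centre with values, `G`-regular invariant -/

section Descent

variable (L : Type) [Field L] [NumberField L] [IsCMField L] (α : Fin 2 → L)
  [∀ w : {w : InfinitePlace L // IsComplex w}, MeasurableSpace (archLocal L 2 (Matrix.diagonal α) w)]
  [∀ w : {w : InfinitePlace L // IsComplex w}, BorelSpace (archLocal L 2 (Matrix.diagonal α) w)]
  (νw : ∀ w : {w : InfinitePlace L // IsComplex w}, Measure (archLocal L 2 (Matrix.diagonal α) w)) [∀ w, (νw w).IsHaarMeasure]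
  (z : {w : InfinitePlace L // IsComplex w} → Circle)

open scoped Classical in
/-- **THE DESCENT WITH VALUES, `G`-REGULAR INVARIANT** (value twin of ★ `apply_center_eq_zero_of_forall_sum_integral_pi_eq_zero_of_ne_center`).  On the endoscopic-type 2-block (`σ_wα` real of
opposite signs at EVERY complex place) there are constants `C : W → ℝ`, all non-zero (§2's constants, place by place), such that: for every smooth `Θ` with `g ↦ Θ ↑↑g` compactly supported,
every `S₀` and every CLOSED FORM `Ψ : Finset W → (W → Fin 2 → S¹) → E` which (top) reads the symmetrised mixed orbital integral at the `G`-regular data of `S₀` —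
`Σ_ε ∫ Θ d(⊗ M(S₀, u, ε)) = Ψ(S₀, u)` whenever `u_w 0 ≠ u_w 1`, `u_w 0 ≠ z_w`, `u_w 1 ≠ z_w` on `S₀` — and (step) descends along the central curves with the constants `C` — for `S ⊆ S₀`,
`w₁ ∈ S`, `u` `G`-regular on `S ∖ w₁`, the function `ψ ↦ 2 sin ψ • Ψ(S, u[w₁ ↦ (z e^{iψ}, z e^{−iψ})])` is differentiable on `𝓝[≠] 0` with derivative tending to `C_{w₁} • Ψ(S ∖ w₁, u)` —
the symmetrised mixed orbital integral is read by `Ψ` ALL THE WAY DOWN: `Σ_ε ∫ Θ d(⊗ M(S₀ ∖ T, u, ε)) = Ψ(S₀ ∖ T, u)` for every `T` and every `u` `G`-regular on `S₀ ∖ T`.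
(Downward induction on `T`; each step is §2 with `r = 2 sin ψ • Ψ(S, u_ψ)`, `ℓ = C_{w₁} • Ψ(S ∖ w₁, u)`, the invariant surviving along the curve by ★ `mul_exp_ne_mul_exp_neg`,
★ `mul_exp_ne_self`, ★ `mul_exp_neg_ne_self`.) [cite: Rogawski1990, §8.2 Prop. 8.2.1 pp. 118–119; §14.5 Lemma 14.5.2 (b) p. 238] [cite: Varadarajan1989, §6.4 Thm. 22] -/
theorem exists_const_sum_integral_pi_eq_of_closedForm {E : Type*} [NormedAddCommGroup E] [NormedSpace ℝ E] [CompleteSpace E]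
    (hα : ∀ i, α i ≠ 0)
    (hreal : ∀ (w : {w : InfinitePlace L // IsComplex w}) (i : Fin 2), (w.1.embedding (α i)).im = 0)
    (hsgn : ∀ w : {w : InfinitePlace L // IsComplex w}, (w.1.embedding (α 0)).re * (w.1.embedding (α 1)).re < 0) :
    ∃ C : {w : InfinitePlace L // IsComplex w} → ℝ, (∀ w, C w ≠ 0) ∧
      ∀ (Θ : Matrix (Fin 2) (Fin 2) (mixedSpace L) → E), ContDiff ℝ (⊤ : ℕ∞) Θ →
        HasCompactSupport (fun g : arch (↥(maximalRealSubfield L)) L (IsCMField.complexConj L) 2 (Matrix.diagonal α) =>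
          Θ ((g : GL (Fin 2) (mixedSpace L)) : Matrix (Fin 2) (Fin 2) (mixedSpace L))) →
        ∀ (S₀ : Finset {w : InfinitePlace L // IsComplex w})
          (Ψ : Finset {w : InfinitePlace L // IsComplex w} → ({w : InfinitePlace L // IsComplex w} → Fin 2 → Circle) → E),
          (∀ u : {w : InfinitePlace L // IsComplex w} → Fin 2 → Circle, (∀ w ∈ S₀, u w 0 ≠ u w 1 ∧ u w 0 ≠ z w ∧ u w 1 ≠ z w) →
            ∑ ε : {w : InfinitePlace L // IsComplex w} → Bool,
              ∫ o, Θ (((((archPiEquivCM 2 L (Matrix.diagonal α)).symm o) : arch (↥(maximalRealSubfield L)) L (IsCMField.complexConj L) 2 (Matrix.diagonal α)) : GL (Fin 2) (mixedSpace L)) : Matrix (Fin 2) (Fin 2) (mixedSpace L))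
                ∂(Measure.pi (fun w : {w : InfinitePlace L // IsComplex w} =>
                if w ∈ S₀ then (νw w).map (fun g : archLocal L 2 (Matrix.diagonal α) w =>
                  g * ⟨circleDiagonal 2 (if ε w then u w ∘ ⇑(Equiv.swap (0 : Fin 2) 1) else u w), circleDiagonal_mem_archLocal_diagonal L 2 α w _⟩ * g⁻¹)
                else Measure.dirac (⟨circleDiagonal 2 ![z w, z w], circleDiagonal_mem_archLocal_diagonal L 2 α w _⟩ : archLocal L 2 (Matrix.diagonal α) w))) = Ψ S₀ u) →
          (∀ S : Finset {w : InfinitePlace L // IsComplex w}, S ⊆ S₀ → ∀ w₁ ∈ S, ∀ u : {w : InfinitePlace L // IsComplex w} → Fin 2 → Circle,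
            (∀ w ∈ S, w ≠ w₁ → u w 0 ≠ u w 1 ∧ u w 0 ≠ z w ∧ u w 1 ≠ z w) →
            (∀ᶠ ψ in 𝓝[≠] (0 : ℝ), DifferentiableAt ℝ (fun ψ : ℝ => (2 * Real.sin ψ) • Ψ S (Function.update u w₁ ![z w₁ * Circle.exp ψ, z w₁ * Circle.exp (-ψ)])) ψ) ∧
            Tendsto (fun ψ : ℝ => deriv (fun ψ : ℝ => (2 * Real.sin ψ) • Ψ S (Function.update u w₁ ![z w₁ * Circle.exp ψ, z w₁ * Circle.exp (-ψ)])) ψ) (𝓝[≠] 0)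
              (𝓝 (C w₁ • Ψ (S.erase w₁) u))) →
          ∀ (T : Finset {w : InfinitePlace L // IsComplex w}) (u : {w : InfinitePlace L // IsComplex w} → Fin 2 → Circle),
            (∀ w ∈ S₀ \ T, u w 0 ≠ u w 1 ∧ u w 0 ≠ z w ∧ u w 1 ≠ z w) →
            ∑ ε : {w : InfinitePlace L // IsComplex w} → Bool,
              ∫ o, Θ (((((archPiEquivCM 2 L (Matrix.diagonal α)).symm o) : arch (↥(maximalRealSubfield L)) L (IsCMField.complexConj L) 2 (Matrix.diagonal α)) : GL (Fin 2) (mixedSpace L)) : Matrix (Fin 2) (Fin 2) (mixedSpace L))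
                ∂(Measure.pi (fun w : {w : InfinitePlace L // IsComplex w} =>
                if w ∈ (S₀ \ T) then (νw w).map (fun g : archLocal L 2 (Matrix.diagonal α) w =>
                  g * ⟨circleDiagonal 2 (if ε w then u w ∘ ⇑(Equiv.swap (0 : Fin 2) 1) else u w), circleDiagonal_mem_archLocal_diagonal L 2 α w _⟩ * g⁻¹)
                else Measure.dirac (⟨circleDiagonal 2 ![z w, z w], circleDiagonal_mem_archLocal_diagonal L 2 α w _⟩ : archLocal L 2 (Matrix.diagonal α) w))) = Ψ (S₀ \ T) u := by
  -- the per-place constants of §2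
  have hstep := fun w₁ : {w : InfinitePlace L // IsComplex w} =>
    exists_const_sum_integral_pi_erase_eq_inv_smul (E := E) L α νw z hα w₁ (hreal w₁) (hsgn w₁)
  choose C hC hS using hstep
  refine ⟨C, hC, ?_⟩
  intro Θ hΘ hΘc S₀ Ψ htop hΨ T
  induction T using Finset.induction_on with
  | empty =>
    intro u hu
    rw [Finset.sdiff_empty] at hu ⊢
    exact htop u hu
  | insert w₁ T hw₁T ih =>
    intro u hu
    rw [Finset.sdiff_insert] at hu ⊢
    by_cases hmem : w₁ ∈ S₀ \ T
    · have hIoo : ∀ᶠ ψ : ℝ in 𝓝[≠] 0, ψ ∈ Ioo (-1 : ℝ) 1 ∧ ψ ≠ 0 :=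
        Filter.inter_mem (mem_nhdsWithin_of_mem_nhds (Ioo_mem_nhds (by norm_num) (by norm_num))) self_mem_nhdsWithin
      -- the data along the curve are `G`-regular on `S₀ ∖ T`
      have hcurve : ∀ ψ ∈ Ioo (-1 : ℝ) 1, ψ ≠ 0 → ∀ w ∈ S₀ \ T,
          (Function.update u w₁ ![z w₁ * Circle.exp ψ, z w₁ * Circle.exp (-ψ)]) w 0 ≠ (Function.update u w₁ ![z w₁ * Circle.exp ψ, z w₁ * Circle.exp (-ψ)]) w 1 ∧
          (Function.update u w₁ ![z w₁ * Circle.exp ψ, z w₁ * Circle.exp (-ψ)]) w 0 ≠ z w ∧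
          (Function.update u w₁ ![z w₁ * Circle.exp ψ, z w₁ * Circle.exp (-ψ)]) w 1 ≠ z w := by
        intro ψ hψ hψ0 w hw
        by_cases h : w = w₁
        · subst h
          rw [Function.update_self]
          exact ⟨mul_exp_ne_mul_exp_neg (z w) hψ hψ0, mul_exp_ne_self (z w) hψ hψ0, mul_exp_neg_ne_self (z w) hψ hψ0⟩
        · rw [Function.update_of_ne h]
          exact hu w (Finset.mem_erase.2 ⟨h, hw⟩)
      obtain ⟨hΨd, hΨl⟩ := hΨ (S₀ \ T) Finset.sdiff_subset w₁ hmem u (fun w hw hne => hu w (Finset.mem_erase.2 ⟨hne, hw⟩))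
      have h := hS w₁ Θ hΘ hΘc (S₀ \ T) hmem u (fun w hw hne => (hu w (Finset.mem_erase.2 ⟨hne, hw⟩)).1)
        (fun ψ : ℝ => (2 * Real.sin ψ) • Ψ (S₀ \ T) (Function.update u w₁ ![z w₁ * Circle.exp ψ, z w₁ * Circle.exp (-ψ)])) (C w₁ • Ψ ((S₀ \ T).erase w₁) u) hΨd hΨl ?_
      · rw [h, smul_smul, inv_mul_cancel₀ (hC w₁), one_smul]
      · filter_upwards [hIoo] with ψ hψ
        rw [ih _ (hcurve ψ hψ.1 hψ.2)]
    · rw [Finset.erase_eq_of_notMem hmem]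
      exact ih u fun w hw => hu w (Finset.mem_erase.2 ⟨ne_of_mem_of_not_mem hw hmem, hw⟩)

omit [∀ w, (νw w).IsHaarMeasure] in
open scoped Classical in
/-- **At `S = ∅` every place carries the Dirac mass at the centre**: `Σ_ε ∫ Θ d(⊗ M(∅, u, ε)) = 2^{|W|} • Θ ↑↑e⁻¹((diag(z_w, z_w))_w)` (`⊗_w δ = δ`, the flips idle).
[cite: Rogawski1990, §14.5 Lemma 14.5.2 (b)(c) p. 238] -/
theorem sum_integral_pi_empty_eq_card_smul_apply_center {E : Type*} [NormedAddCommGroup E] [NormedSpace ℝ E] [CompleteSpace E]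
    (Θ : Matrix (Fin 2) (Fin 2) (mixedSpace L) → E) (u : {w : InfinitePlace L // IsComplex w} → Fin 2 → Circle) :
    ∑ ε : {w : InfinitePlace L // IsComplex w} → Bool,
      ∫ o, Θ (((((archPiEquivCM 2 L (Matrix.diagonal α)).symm o) : arch (↥(maximalRealSubfield L)) L (IsCMField.complexConj L) 2 (Matrix.diagonal α)) : GL (Fin 2) (mixedSpace L)) : Matrix (Fin 2) (Fin 2) (mixedSpace L))
        ∂(Measure.pi (fun w : {w : InfinitePlace L // IsComplex w} =>
        if w ∈ (∅ : Finset {w : InfinitePlace L // IsComplex w}) then (νw w).map (fun g : archLocal L 2 (Matrix.diagonal α) w =>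
          g * ⟨circleDiagonal 2 (if ε w then u w ∘ ⇑(Equiv.swap (0 : Fin 2) 1) else u w), circleDiagonal_mem_archLocal_diagonal L 2 α w _⟩ * g⁻¹)
        else Measure.dirac (⟨circleDiagonal 2 ![z w, z w], circleDiagonal_mem_archLocal_diagonal L 2 α w _⟩ : archLocal L 2 (Matrix.diagonal α) w))) =
      (Fintype.card ({w : InfinitePlace L // IsComplex w} → Bool) : ℝ) •
        Θ (((((archPiEquivCM 2 L (Matrix.diagonal α)).symm (fun w : {w : InfinitePlace L // IsComplex w} => (⟨circleDiagonal 2 ![z w, z w], circleDiagonal_mem_archLocal_diagonal L 2 α w _⟩ : archLocal L 2 (Matrix.diagonal α) w))) : arch (↥(maximalRealSubfield L)) L (IsCMField.complexConj L) 2 (Matrix.diagonal α)) : GL (Fin 2) (mixedSpace L)) : Matrix (Fin 2) (Fin 2) (mixedSpace L)) := by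
  simp only [Finset.notMem_empty, ↓reduceIte]
  rw [pi_dirac_eq_dirac, integral_dirac, Finset.sum_const, Finset.card_univ, ← Nat.cast_smul_eq_nsmul ℝ]

open scoped Classical in
/-- **THE VALUE AT THE CENTRE** (value twin of ★ `apply_center_eq_zero_of_forall_sum_integral_pi_eq_zero_of_ne_center`): with the constants `C` of `exists_const_sum_integral_pi_eq_of_closedForm`,
for every `Θ`, `S₀` and closed form `Ψ` satisfying (top) and (step) there, `2^{|W|} • Θ ↑↑e⁻¹((diag(z_w, z_w))_w) = Ψ(∅, u)` for every `u` `G`-regular on `S₀` — in U6: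
`aH(γ_H ⊗ 1) = 2^{−|W|} · Ψ(∅)`, the product of the per-place `H`-wall data of the `G′`-side divided by Harish-Chandra's constants.
[cite: Rogawski1990, §8.2 Prop. 8.2.1 pp. 118–119; §14.5 Lemma 14.5.2 (b) p. 238] [cite: Varadarajan1989, §6.4 Thm. 22] -/
theorem exists_const_card_smul_apply_center_eq_of_closedForm {E : Type*} [NormedAddCommGroup E] [NormedSpace ℝ E] [CompleteSpace E]
    (hα : ∀ i, α i ≠ 0)
    (hreal : ∀ (w : {w : InfinitePlace L // IsComplex w}) (i : Fin 2), (w.1.embedding (α i)).im = 0)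
    (hsgn : ∀ w : {w : InfinitePlace L // IsComplex w}, (w.1.embedding (α 0)).re * (w.1.embedding (α 1)).re < 0) :
    ∃ C : {w : InfinitePlace L // IsComplex w} → ℝ, (∀ w, C w ≠ 0) ∧
      ∀ (Θ : Matrix (Fin 2) (Fin 2) (mixedSpace L) → E), ContDiff ℝ (⊤ : ℕ∞) Θ →
        HasCompactSupport (fun g : arch (↥(maximalRealSubfield L)) L (IsCMField.complexConj L) 2 (Matrix.diagonal α) =>
          Θ ((g : GL (Fin 2) (mixedSpace L)) : Matrix (Fin 2) (Fin 2) (mixedSpace L))) →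
        ∀ (S₀ : Finset {w : InfinitePlace L // IsComplex w})
          (Ψ : Finset {w : InfinitePlace L // IsComplex w} → ({w : InfinitePlace L // IsComplex w} → Fin 2 → Circle) → E),
          (∀ u : {w : InfinitePlace L // IsComplex w} → Fin 2 → Circle, (∀ w ∈ S₀, u w 0 ≠ u w 1 ∧ u w 0 ≠ z w ∧ u w 1 ≠ z w) →
            ∑ ε : {w : InfinitePlace L // IsComplex w} → Bool,
              ∫ o, Θ (((((archPiEquivCM 2 L (Matrix.diagonal α)).symm o) : arch (↥(maximalRealSubfield L)) L (IsCMField.complexConj L) 2 (Matrix.diagonal α)) : GL (Fin 2) (mixedSpace L)) : Matrix (Fin 2) (Fin 2) (mixedSpace L))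
                ∂(Measure.pi (fun w : {w : InfinitePlace L // IsComplex w} =>
                if w ∈ S₀ then (νw w).map (fun g : archLocal L 2 (Matrix.diagonal α) w =>
                  g * ⟨circleDiagonal 2 (if ε w then u w ∘ ⇑(Equiv.swap (0 : Fin 2) 1) else u w), circleDiagonal_mem_archLocal_diagonal L 2 α w _⟩ * g⁻¹)
                else Measure.dirac (⟨circleDiagonal 2 ![z w, z w], circleDiagonal_mem_archLocal_diagonal L 2 α w _⟩ : archLocal L 2 (Matrix.diagonal α) w))) = Ψ S₀ u) →
          (∀ S : Finset {w : InfinitePlace L // IsComplex w}, S ⊆ S₀ → ∀ w₁ ∈ S, ∀ u : {w : InfinitePlace L // IsComplex w} → Fin 2 → Circle,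
            (∀ w ∈ S, w ≠ w₁ → u w 0 ≠ u w 1 ∧ u w 0 ≠ z w ∧ u w 1 ≠ z w) →
            (∀ᶠ ψ in 𝓝[≠] (0 : ℝ), DifferentiableAt ℝ (fun ψ : ℝ => (2 * Real.sin ψ) • Ψ S (Function.update u w₁ ![z w₁ * Circle.exp ψ, z w₁ * Circle.exp (-ψ)])) ψ) ∧
            Tendsto (fun ψ : ℝ => deriv (fun ψ : ℝ => (2 * Real.sin ψ) • Ψ S (Function.update u w₁ ![z w₁ * Circle.exp ψ, z w₁ * Circle.exp (-ψ)])) ψ) (𝓝[≠] 0)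
              (𝓝 (C w₁ • Ψ (S.erase w₁) u))) →
          ∀ u : {w : InfinitePlace L // IsComplex w} → Fin 2 → Circle,
            (Fintype.card ({w : InfinitePlace L // IsComplex w} → Bool) : ℝ) •
              Θ (((((archPiEquivCM 2 L (Matrix.diagonal α)).symm (fun w : {w : InfinitePlace L // IsComplex w} => (⟨circleDiagonal 2 ![z w, z w], circleDiagonal_mem_archLocal_diagonal L 2 α w _⟩ : archLocal L 2 (Matrix.diagonal α) w))) : arch (↥(maximalRealSubfield L)) L (IsCMField.complexConj L) 2 (Matrix.diagonal α)) : GL (Fin 2) (mixedSpace L)) : Matrix (Fin 2) (Fin 2) (mixedSpace L)) = Ψ ∅ u := by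
  obtain ⟨C, hC, h⟩ := exists_const_sum_integral_pi_eq_of_closedForm (E := E) L α νw z hα hreal hsgn
  refine ⟨C, hC, ?_⟩
  intro Θ hΘ hΘc S₀ Ψ htop hΨ u
  have h0 := h Θ hΘ hΘc S₀ Ψ htop hΨ S₀ u (fun w hw => absurd hw (by rw [Finset.sdiff_self]; exact Finset.notMem_empty w))
  rw [Finset.sdiff_self] at h0
  rwa [sum_integral_pi_empty_eq_card_smul_apply_center] at h0

end Descent

/-! ## §4 The descent with values under a GENERAL per-place regularity predicate (semiregular centres: the avoided `U(Φ₁)`-angle differs from the central 2-block angle) -/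

section DescentReg

variable (L : Type) [Field L] [NumberField L] [IsCMField L] (α : Fin 2 → L)
  [∀ w : {w : InfinitePlace L // IsComplex w}, MeasurableSpace (archLocal L 2 (Matrix.diagonal α) w)]
  [∀ w : {w : InfinitePlace L // IsComplex w}, BorelSpace (archLocal L 2 (Matrix.diagonal α) w)]
  (νw : ∀ w : {w : InfinitePlace L // IsComplex w}, Measure (archLocal L 2 (Matrix.diagonal α) w)) [∀ w, (νw w).IsHaarMeasure]
  (z : {w : InfinitePlace L // IsComplex w} → Circle)

/-- Along the central curve the moving angles avoid any angle `d ≠ z` NEAR `ψ = 0`: `z e^{iψ} ≠ d` eventually (continuity at `ψ = 0`, where the value is `z ≠ d`).  In U6 `d_w = σ_w e₂ ≠ σ_w e₁ = z_w`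
is the frozen `U(Φ₁)`-angle of the semiregular point `γ_H = (e₁•1₂, e₂)`. [cite: Rogawski1990, §8.2 Prop. 8.2.1 p. 118] -/
theorem eventually_mul_exp_ne {zc d : Circle} (h : zc ≠ d) : ∀ᶠ ψ : ℝ in 𝓝 0, zc * Circle.exp ψ ≠ d := by
  have hc : ContinuousAt (fun ψ : ℝ => zc * Circle.exp ψ) 0 := (continuous_const.mul Circle.exp.continuous).continuousAt
  have h0 : (fun ψ : ℝ => zc * Circle.exp ψ) 0 ≠ d := by
    simp only [Circle.exp_zero, mul_one]
    exact h
  exact hc.eventually_ne h0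

/-- The two curve angles `z e^{iψ}`, `z e^{−iψ}` are distinct and both avoid `d ≠ z` on a punctured neighbourhood of `ψ = 0` — the semiregular instance of the regularity predicate of
`exists_const_sum_integral_pi_eq_of_closedForm_of_reg` (`Reg_w v :⇔ v 0 ≠ v 1 ∧ v 0 ≠ d_w ∧ v 1 ≠ d_w`). [cite: Rogawski1990, §8.2 Prop. 8.2.1 p. 118] -/
theorem eventually_nhdsWithin_curve_ne_and_ne {zc d : Circle} (h : zc ≠ d) :
    ∀ᶠ ψ : ℝ in 𝓝[≠] 0, (![zc * Circle.exp ψ, zc * Circle.exp (-ψ)] 0 ≠ ![zc * Circle.exp ψ, zc * Circle.exp (-ψ)] 1) ∧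
      ![zc * Circle.exp ψ, zc * Circle.exp (-ψ)] 0 ≠ d ∧ ![zc * Circle.exp ψ, zc * Circle.exp (-ψ)] 1 ≠ d := by
  have hIoo : ∀ᶠ ψ : ℝ in 𝓝[≠] 0, ψ ∈ Ioo (-1 : ℝ) 1 ∧ ψ ≠ 0 :=
    Filter.inter_mem (mem_nhdsWithin_of_mem_nhds (Ioo_mem_nhds (by norm_num) (by norm_num))) self_mem_nhdsWithin
  have hplus : ∀ᶠ ψ : ℝ in 𝓝[≠] 0, zc * Circle.exp ψ ≠ d := mem_nhdsWithin_of_mem_nhds (eventually_mul_exp_ne h)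
  have hminus : ∀ᶠ ψ : ℝ in 𝓝[≠] 0, zc * Circle.exp (-ψ) ≠ d := by
    have hneg : Tendsto (fun ψ : ℝ => -ψ) (𝓝[≠] (0 : ℝ)) (𝓝 0) := by
      simpa only [neg_zero] using (continuous_neg.tendsto (0 : ℝ)).mono_left nhdsWithin_le_nhds
    exact hneg.eventually (eventually_mul_exp_ne h)
  filter_upwards [hIoo, hplus, hminus] with ψ hψ hp hm
  exact ⟨mul_exp_ne_mul_exp_neg zc hψ.1 hψ.2, hp, hm⟩

open scoped Classical in
/-- **THE DESCENT WITH VALUES UNDER A GENERAL REGULARITY PREDICATE** (generalises `exists_const_sum_integral_pi_eq_of_closedForm`, whose invariant `u_w i ≠ z_w` is the (S-c) one where the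
frozen `U(Φ₁)`-angle EQUALS the central 2-block angle).  Data: a per-place predicate `Reg_w` on 2-block torus data implying distinct angles (`Reg_w v → v 0 ≠ v 1`, Radon-ness of the orbit
measures) and holding along the central curve near `ψ = 0` (`∀ᶠ ψ in 𝓝[≠] 0, Reg_w (z_w e^{iψ}, z_w e^{−iψ})` — for the `G`-regularity of the SEMIREGULAR case take
`Reg_w v :⇔ v 0 ≠ v 1 ∧ v i ≠ d_w` with `d_w ≠ z_w`, ★ `eventually_nhdsWithin_curve_ne_and_ne`).  Then with the SAME constants `C_w ≠ 0` of §2: for every `Θ`, `S₀` and closed form `Ψ`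
with (top) `I(S₀, u) = Ψ(S₀, u)` at `Reg`-regular `u` and (step) along the central curves at `Reg`-regular data, `I(S₀ ∖ T, u) = Ψ(S₀ ∖ T, u)` for every `T` and every `u` `Reg`-regular on
`S₀ ∖ T`. [cite: Rogawski1990, §8.2 Prop. 8.2.1 pp. 118–119; §14.5 Lemma 14.5.2 (b) p. 238] [cite: Varadarajan1989, §6.4 Thm. 22] -/
theorem exists_const_sum_integral_pi_eq_of_closedForm_of_reg {E : Type*} [NormedAddCommGroup E] [NormedSpace ℝ E] [CompleteSpace E]
    (hα : ∀ i, α i ≠ 0)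
    (hreal : ∀ (w : {w : InfinitePlace L // IsComplex w}) (i : Fin 2), (w.1.embedding (α i)).im = 0)
    (hsgn : ∀ w : {w : InfinitePlace L // IsComplex w}, (w.1.embedding (α 0)).re * (w.1.embedding (α 1)).re < 0) :
    ∃ C : {w : InfinitePlace L // IsComplex w} → ℝ, (∀ w, C w ≠ 0) ∧
      ∀ (Reg : {w : InfinitePlace L // IsComplex w} → (Fin 2 → Circle) → Prop),
        (∀ w v, Reg w v → v 0 ≠ v 1) →
        (∀ w, ∀ᶠ ψ : ℝ in 𝓝[≠] 0, Reg w ![z w * Circle.exp ψ, z w * Circle.exp (-ψ)]) →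
      ∀ (Θ : Matrix (Fin 2) (Fin 2) (mixedSpace L) → E), ContDiff ℝ (⊤ : ℕ∞) Θ →
        HasCompactSupport (fun g : arch (↥(maximalRealSubfield L)) L (IsCMField.complexConj L) 2 (Matrix.diagonal α) =>
          Θ ((g : GL (Fin 2) (mixedSpace L)) : Matrix (Fin 2) (Fin 2) (mixedSpace L))) →
        ∀ (S₀ : Finset {w : InfinitePlace L // IsComplex w})
          (Ψ : Finset {w : InfinitePlace L // IsComplex w} → ({w : InfinitePlace L // IsComplex w} → Fin 2 → Circle) → E),
          (∀ u : {w : InfinitePlace L // IsComplex w} → Fin 2 → Circle, (∀ w ∈ S₀, Reg w (u w)) →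
            ∑ ε : {w : InfinitePlace L // IsComplex w} → Bool,
              ∫ o, Θ (((((archPiEquivCM 2 L (Matrix.diagonal α)).symm o) : arch (↥(maximalRealSubfield L)) L (IsCMField.complexConj L) 2 (Matrix.diagonal α)) : GL (Fin 2) (mixedSpace L)) : Matrix (Fin 2) (Fin 2) (mixedSpace L))
                ∂(Measure.pi (fun w : {w : InfinitePlace L // IsComplex w} =>
                if w ∈ S₀ then (νw w).map (fun g : archLocal L 2 (Matrix.diagonal α) w =>
                  g * ⟨circleDiagonal 2 (if ε w then u w ∘ ⇑(Equiv.swap (0 : Fin 2) 1) else u w), circleDiagonal_mem_archLocal_diagonal L 2 α w _⟩ * g⁻¹)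
                else Measure.dirac (⟨circleDiagonal 2 ![z w, z w], circleDiagonal_mem_archLocal_diagonal L 2 α w _⟩ : archLocal L 2 (Matrix.diagonal α) w))) = Ψ S₀ u) →
          (∀ S : Finset {w : InfinitePlace L // IsComplex w}, S ⊆ S₀ → ∀ w₁ ∈ S, ∀ u : {w : InfinitePlace L // IsComplex w} → Fin 2 → Circle,
            (∀ w ∈ S, w ≠ w₁ → Reg w (u w)) →
            (∀ᶠ ψ in 𝓝[≠] (0 : ℝ), DifferentiableAt ℝ (fun ψ : ℝ => (2 * Real.sin ψ) • Ψ S (Function.update u w₁ ![z w₁ * Circle.exp ψ, z w₁ * Circle.exp (-ψ)])) ψ) ∧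
            Tendsto (fun ψ : ℝ => deriv (fun ψ : ℝ => (2 * Real.sin ψ) • Ψ S (Function.update u w₁ ![z w₁ * Circle.exp ψ, z w₁ * Circle.exp (-ψ)])) ψ) (𝓝[≠] 0)
              (𝓝 (C w₁ • Ψ (S.erase w₁) u))) →
          ∀ (T : Finset {w : InfinitePlace L // IsComplex w}) (u : {w : InfinitePlace L // IsComplex w} → Fin 2 → Circle),
            (∀ w ∈ S₀ \ T, Reg w (u w)) →
            ∑ ε : {w : InfinitePlace L // IsComplex w} → Bool,
              ∫ o, Θ (((((archPiEquivCM 2 L (Matrix.diagonal α)).symm o) : arch (↥(maximalRealSubfield L)) L (IsCMField.complexConj L) 2 (Matrix.diagonal α)) : GL (Fin 2) (mixedSpace L)) : Matrix (Fin 2) (Fin 2) (mixedSpace L))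
                ∂(Measure.pi (fun w : {w : InfinitePlace L // IsComplex w} =>
                if w ∈ (S₀ \ T) then (νw w).map (fun g : archLocal L 2 (Matrix.diagonal α) w =>
                  g * ⟨circleDiagonal 2 (if ε w then u w ∘ ⇑(Equiv.swap (0 : Fin 2) 1) else u w), circleDiagonal_mem_archLocal_diagonal L 2 α w _⟩ * g⁻¹)
                else Measure.dirac (⟨circleDiagonal 2 ![z w, z w], circleDiagonal_mem_archLocal_diagonal L 2 α w _⟩ : archLocal L 2 (Matrix.diagonal α) w))) = Ψ (S₀ \ T) u := by
  -- the per-place constants of §2 (the same as in `exists_const_sum_integral_pi_eq_of_closedForm`)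
  have hstep := fun w₁ : {w : InfinitePlace L // IsComplex w} =>
    exists_const_sum_integral_pi_erase_eq_inv_smul (E := E) L α νw z hα w₁ (hreal w₁) (hsgn w₁)
  choose C hC hS using hstep
  refine ⟨C, hC, ?_⟩
  intro Reg hReg hcurve Θ hΘ hΘc S₀ Ψ htop hΨ T
  induction T using Finset.induction_on with
  | empty =>
    intro u hu
    rw [Finset.sdiff_empty] at hu ⊢
    exact htop u hu
  | insert w₁ T hw₁T ih =>
    intro u hu
    rw [Finset.sdiff_insert] at hu ⊢
    by_cases hmem : w₁ ∈ S₀ \ T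
    · -- the data along the curve are `Reg`-regular on `S₀ ∖ T`, for `ψ` near `0`
      have hcurveS : ∀ᶠ ψ : ℝ in 𝓝[≠] 0, ∀ w ∈ S₀ \ T, Reg w ((Function.update u w₁ ![z w₁ * Circle.exp ψ, z w₁ * Circle.exp (-ψ)]) w) := by
        filter_upwards [hcurve w₁] with ψ hψ
        intro w hw
        by_cases h : w = w₁
        · subst h
          rw [Function.update_self]
          exact hψ
        · rw [Function.update_of_ne h]
          exact hu w (Finset.mem_erase.2 ⟨h, hw⟩)
      obtain ⟨hΨd, hΨl⟩ := hΨ (S₀ \ T) Finset.sdiff_subset w₁ hmem u (fun w hw hne => hu w (Finset.mem_erase.2 ⟨hne, hw⟩))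
      have h := hS w₁ Θ hΘ hΘc (S₀ \ T) hmem u (fun w hw hne => hReg w _ (hu w (Finset.mem_erase.2 ⟨hne, hw⟩)))
        (fun ψ : ℝ => (2 * Real.sin ψ) • Ψ (S₀ \ T) (Function.update u w₁ ![z w₁ * Circle.exp ψ, z w₁ * Circle.exp (-ψ)])) (C w₁ • Ψ ((S₀ \ T).erase w₁) u) hΨd hΨl ?_
      · rw [h, smul_smul, inv_mul_cancel₀ (hC w₁), one_smul]
      · filter_upwards [hcurveS] with ψ hψ
        rw [ih _ hψ]
    · rw [Finset.erase_eq_of_notMem hmem]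
      exact ih u fun w hw => hu w (Finset.mem_erase.2 ⟨ne_of_mem_of_not_mem hw hmem, hw⟩)

open scoped Classical in
/-- **THE VALUE AT THE CENTRE, GENERAL REGULARITY PREDICATE**: under the hypotheses of `exists_const_sum_integral_pi_eq_of_closedForm_of_reg` (same constants `C`),
`2^{|W|} • Θ ↑↑e⁻¹((diag(z_w, z_w))_w) = Ψ(∅, u)` for every `u`.  In U6 (semiregular `γ_H = (e₁•1₂, e₂)`, `Reg_w v :⇔ v 0 ≠ v 1 ∧ v i ≠ σ_w e₂`): `aH(γ_H ⊗ 1) = 2^{−|W|} · Ψ(∅)`.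
[cite: Rogawski1990, §8.2 Prop. 8.2.1 pp. 118–119; §14.5 Lemma 14.5.2 (b) p. 238] [cite: Varadarajan1989, §6.4 Thm. 22] -/
theorem exists_const_card_smul_apply_center_eq_of_closedForm_of_reg {E : Type*} [NormedAddCommGroup E] [NormedSpace ℝ E] [CompleteSpace E]
    (hα : ∀ i, α i ≠ 0)
    (hreal : ∀ (w : {w : InfinitePlace L // IsComplex w}) (i : Fin 2), (w.1.embedding (α i)).im = 0)
    (hsgn : ∀ w : {w : InfinitePlace L // IsComplex w}, (w.1.embedding (α 0)).re * (w.1.embedding (α 1)).re < 0) :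
    ∃ C : {w : InfinitePlace L // IsComplex w} → ℝ, (∀ w, C w ≠ 0) ∧
      ∀ (Reg : {w : InfinitePlace L // IsComplex w} → (Fin 2 → Circle) → Prop),
        (∀ w v, Reg w v → v 0 ≠ v 1) →
        (∀ w, ∀ᶠ ψ : ℝ in 𝓝[≠] 0, Reg w ![z w * Circle.exp ψ, z w * Circle.exp (-ψ)]) →
      ∀ (Θ : Matrix (Fin 2) (Fin 2) (mixedSpace L) → E), ContDiff ℝ (⊤ : ℕ∞) Θ →
        HasCompactSupport (fun g : arch (↥(maximalRealSubfield L)) L (IsCMField.complexConj L) 2 (Matrix.diagonal α) =>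
          Θ ((g : GL (Fin 2) (mixedSpace L)) : Matrix (Fin 2) (Fin 2) (mixedSpace L))) →
        ∀ (S₀ : Finset {w : InfinitePlace L // IsComplex w})
          (Ψ : Finset {w : InfinitePlace L // IsComplex w} → ({w : InfinitePlace L // IsComplex w} → Fin 2 → Circle) → E),
          (∀ u : {w : InfinitePlace L // IsComplex w} → Fin 2 → Circle, (∀ w ∈ S₀, Reg w (u w)) →
            ∑ ε : {w : InfinitePlace L // IsComplex w} → Bool,
              ∫ o, Θ (((((archPiEquivCM 2 L (Matrix.diagonal α)).symm o) : arch (↥(maximalRealSubfield L)) L (IsCMField.complexConj L) 2 (Matrix.diagonal α)) : GL (Fin 2) (mixedSpace L)) : Matrix (Fin 2) (Fin 2) (mixedSpace L))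
                ∂(Measure.pi (fun w : {w : InfinitePlace L // IsComplex w} =>
                if w ∈ S₀ then (νw w).map (fun g : archLocal L 2 (Matrix.diagonal α) w =>
                  g * ⟨circleDiagonal 2 (if ε w then u w ∘ ⇑(Equiv.swap (0 : Fin 2) 1) else u w), circleDiagonal_mem_archLocal_diagonal L 2 α w _⟩ * g⁻¹)
                else Measure.dirac (⟨circleDiagonal 2 ![z w, z w], circleDiagonal_mem_archLocal_diagonal L 2 α w _⟩ : archLocal L 2 (Matrix.diagonal α) w))) = Ψ S₀ u) →
          (∀ S : Finset {w : InfinitePlace L // IsComplex w}, S ⊆ S₀ → ∀ w₁ ∈ S, ∀ u : {w : InfinitePlace L // IsComplex w} → Fin 2 → Circle,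
            (∀ w ∈ S, w ≠ w₁ → Reg w (u w)) →
            (∀ᶠ ψ in 𝓝[≠] (0 : ℝ), DifferentiableAt ℝ (fun ψ : ℝ => (2 * Real.sin ψ) • Ψ S (Function.update u w₁ ![z w₁ * Circle.exp ψ, z w₁ * Circle.exp (-ψ)])) ψ) ∧
            Tendsto (fun ψ : ℝ => deriv (fun ψ : ℝ => (2 * Real.sin ψ) • Ψ S (Function.update u w₁ ![z w₁ * Circle.exp ψ, z w₁ * Circle.exp (-ψ)])) ψ) (𝓝[≠] 0)
              (𝓝 (C w₁ • Ψ (S.erase w₁) u))) →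
          ∀ u : {w : InfinitePlace L // IsComplex w} → Fin 2 → Circle,
            (Fintype.card ({w : InfinitePlace L // IsComplex w} → Bool) : ℝ) •
              Θ (((((archPiEquivCM 2 L (Matrix.diagonal α)).symm (fun w : {w : InfinitePlace L // IsComplex w} => (⟨circleDiagonal 2 ![z w, z w], circleDiagonal_mem_archLocal_diagonal L 2 α w _⟩ : archLocal L 2 (Matrix.diagonal α) w))) : arch (↥(maximalRealSubfield L)) L (IsCMField.complexConj L) 2 (Matrix.diagonal α)) : GL (Fin 2) (mixedSpace L)) : Matrix (Fin 2) (Fin 2) (mixedSpace L)) = Ψ ∅ u := by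
  obtain ⟨C, hC, h⟩ := exists_const_sum_integral_pi_eq_of_closedForm_of_reg (E := E) L α νw z hα hreal hsgn
  refine ⟨C, hC, ?_⟩
  intro Reg hReg hcurve Θ hΘ hΘc S₀ Ψ htop hΨ u
  have h0 := h Reg hReg hcurve Θ hΘ hΘc S₀ Ψ htop hΨ S₀ u (fun w hw => absurd hw (by rw [Finset.sdiff_self]; exact Finset.notMem_empty w))
  rw [Finset.sdiff_self] at h0
  rwa [sum_integral_pi_empty_eq_card_smul_apply_center] at h0

end DescentReg

/-! ## §5 (ED. 3) The H-family's OWN one-step law: `∂_ψ[2 sin ψ • I(S, u[w₁ ↦ z e^{±iψ}])] → C_{w₁} • I(S ∖ w₁, u)` (the `hstep` of the joint place-induction engine) -/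

section StepLaw

variable (L : Type) [Field L] [NumberField L] [IsCMField L] (α : Fin 2 → L)
  [∀ w : {w : InfinitePlace L // IsComplex w}, MeasurableSpace (archLocal L 2 (Matrix.diagonal α) w)]
  [∀ w : {w : InfinitePlace L // IsComplex w}, BorelSpace (archLocal L 2 (Matrix.diagonal α) w)]
  (νw : ∀ w : {w : InfinitePlace L // IsComplex w}, Measure (archLocal L 2 (Matrix.diagonal α) w)) [∀ w, (νw w).IsHaarMeasure]
  (z : {w : InfinitePlace L // IsComplex w} → Circle)

open scoped Classical in
/-- **THE H-SIDE ONE-STEP LAW, DIRECT FORM** (the `r`-free reading of §2, = the `hstep` hypothesis of the joint place-induction engine ★ `K2E4ArchSingularKernelPlaceInduction.eq_of_step_of_regular_eq`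
for the H-state family, K2E4-p09's «V1+» ask 2026-09-03T21:20:04Z).  At a complex place `w₁` (`σ_{w₁}α` real of opposite signs) there is ONE constant `C ≠ 0` (Harish-Chandra's, ★
`exists_tendsto_deriv_two_sin_smul_integral_integral_insert` at `(L, α, w₁, νw w₁)`) such that for every smooth `Θ` with `g ↦ Θ ↑↑g` compactly supported, every `S ∋ w₁` and every `u` regular
on `S ∖ w₁`, the symmetrised mixed orbital integral along the central curve at `w₁` satisfies
`∂_ψ [2 sin ψ • Σ_ε ∫ Θ d(⊗ M(S, u[w₁ ↦ (z e^{iψ}, z e^{−iψ})], ε))] → C • Σ_ε ∫ Θ d(⊗ M(S ∖ w₁, u, ε))` as `ψ → 0`, `ψ ≠ 0`,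
and the function is differentiable at every `0 < |ψ| < 1`.  (Mechanism of ★ p841432 §2: on `0 < |ψ| < 1` the function IS `Σ_ε [ε w₁ ? −g_ε(−ψ) : g_ε(ψ)]` with the engine's `g_ε`; differentiate
termwise, `∂g_ε → C • V_ε` from both sides, `Σ_ε V_ε` = the descended integral.) [cite: Rogawski1990, §8.2 Prop. 8.2.1 pp. 118–119; §14.5 Lemma 14.5.2 (b)(c) p. 238] [cite: Varadarajan1989, §6.4 Thm. 22] -/
theorem exists_const_tendsto_deriv_two_sin_smul_sum_integral_pi {E : Type*} [NormedAddCommGroup E] [NormedSpace ℝ E] [CompleteSpace E]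
    (hα : ∀ i, α i ≠ 0) (w₁ : {w : InfinitePlace L // IsComplex w})
    (hreal : ∀ i, (w₁.1.embedding (α i)).im = 0) (hsgn : (w₁.1.embedding (α 0)).re * (w₁.1.embedding (α 1)).re < 0) :
    ∃ C : ℝ, C ≠ 0 ∧
      ∀ (Θ : Matrix (Fin 2) (Fin 2) (mixedSpace L) → E), ContDiff ℝ (⊤ : ℕ∞) Θ →
        HasCompactSupport (fun g : arch (↥(maximalRealSubfield L)) L (IsCMField.complexConj L) 2 (Matrix.diagonal α) =>
          Θ ((g : GL (Fin 2) (mixedSpace L)) : Matrix (Fin 2) (Fin 2) (mixedSpace L))) →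
        ∀ (S : Finset {w : InfinitePlace L // IsComplex w}), w₁ ∈ S →
        ∀ (u : {w : InfinitePlace L // IsComplex w} → Fin 2 → Circle), (∀ w ∈ S, w ≠ w₁ → u w 0 ≠ u w 1) →
        (∀ ψ ∈ Ioo (-1 : ℝ) 1, ψ ≠ 0 → DifferentiableAt ℝ (fun ψ : ℝ => (2 * Real.sin ψ) • ∑ ε : {w : InfinitePlace L // IsComplex w} → Bool,
          ∫ o, Θ (((((archPiEquivCM 2 L (Matrix.diagonal α)).symm o) : arch (↥(maximalRealSubfield L)) L (IsCMField.complexConj L) 2 (Matrix.diagonal α)) : GL (Fin 2) (mixedSpace L)) : Matrix (Fin 2) (Fin 2) (mixedSpace L))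
              ∂(Measure.pi (fun w : {w : InfinitePlace L // IsComplex w} =>
              if w ∈ S then (νw w).map (fun g : archLocal L 2 (Matrix.diagonal α) w =>
                g * ⟨circleDiagonal 2 (if ε w then (Function.update u w₁ ![z w₁ * Circle.exp ψ, z w₁ * Circle.exp (-ψ)]) w ∘ ⇑(Equiv.swap (0 : Fin 2) 1) else (Function.update u w₁ ![z w₁ * Circle.exp ψ, z w₁ * Circle.exp (-ψ)]) w), circleDiagonal_mem_archLocal_diagonal L 2 α w _⟩ * g⁻¹)
              else Measure.dirac (⟨circleDiagonal 2 ![z w, z w], circleDiagonal_mem_archLocal_diagonal L 2 α w _⟩ : archLocal L 2 (Matrix.diagonal α) w)))) ψ) ∧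
        Tendsto (fun ψ : ℝ => deriv (fun ψ : ℝ => (2 * Real.sin ψ) • ∑ ε : {w : InfinitePlace L // IsComplex w} → Bool,
          ∫ o, Θ (((((archPiEquivCM 2 L (Matrix.diagonal α)).symm o) : arch (↥(maximalRealSubfield L)) L (IsCMField.complexConj L) 2 (Matrix.diagonal α)) : GL (Fin 2) (mixedSpace L)) : Matrix (Fin 2) (Fin 2) (mixedSpace L))
              ∂(Measure.pi (fun w : {w : InfinitePlace L // IsComplex w} =>
              if w ∈ S then (νw w).map (fun g : archLocal L 2 (Matrix.diagonal α) w =>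
                g * ⟨circleDiagonal 2 (if ε w then (Function.update u w₁ ![z w₁ * Circle.exp ψ, z w₁ * Circle.exp (-ψ)]) w ∘ ⇑(Equiv.swap (0 : Fin 2) 1) else (Function.update u w₁ ![z w₁ * Circle.exp ψ, z w₁ * Circle.exp (-ψ)]) w), circleDiagonal_mem_archLocal_diagonal L 2 α w _⟩ * g⁻¹)
              else Measure.dirac (⟨circleDiagonal 2 ![z w, z w], circleDiagonal_mem_archLocal_diagonal L 2 α w _⟩ : archLocal L 2 (Matrix.diagonal α) w)))) ψ)
          (𝓝[≠] 0)
          (𝓝 (C • ∑ ε : {w : InfinitePlace L // IsComplex w} → Bool,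
            ∫ o, Θ (((((archPiEquivCM 2 L (Matrix.diagonal α)).symm o) : arch (↥(maximalRealSubfield L)) L (IsCMField.complexConj L) 2 (Matrix.diagonal α)) : GL (Fin 2) (mixedSpace L)) : Matrix (Fin 2) (Fin 2) (mixedSpace L))
              ∂(Measure.pi (fun w : {w : InfinitePlace L // IsComplex w} =>
              if w ∈ S.erase w₁ then (νw w).map (fun g : archLocal L 2 (Matrix.diagonal α) w =>
                g * ⟨circleDiagonal 2 (if ε w then u w ∘ ⇑(Equiv.swap (0 : Fin 2) 1) else u w), circleDiagonal_mem_archLocal_diagonal L 2 α w _⟩ * g⁻¹)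
              else Measure.dirac (⟨circleDiagonal 2 ![z w, z w], circleDiagonal_mem_archLocal_diagonal L 2 α w _⟩ : archLocal L 2 (Matrix.diagonal α) w))))) := by
  haveI : ∀ w : {w : InfinitePlace L // IsComplex w}, SecondCountableTopology (archLocal L 2 (Matrix.diagonal α) w) := fun w => secondCountableTopology_archLocal L 2 (Matrix.diagonal α) w
  haveI : ∀ w : {w : InfinitePlace L // IsComplex w}, LocallyCompactSpace (archLocal L 2 (Matrix.diagonal α) w) := fun w => locallyCompactSpace_archLocal L 2 (Matrix.diagonal α) w
  -- the engine at `w₁`: ONE constant for all other-place measures, all `Θ`, all `z`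
  obtain ⟨C, hC, hlim⟩ := exists_tendsto_deriv_two_sin_smul_integral_integral_insert (E := E) L α hα w₁ hreal hsgn (νw w₁)
  refine ⟨C, hC, ?_⟩
  intro Θ hΘ hΘc S hw₁ u hu
  -- regularity of `u` on `S ∖ w₁`; the families `M(S ∖ w₁, u, ε)` are Radon and σ-finite
  have hu' : ∀ w ∈ S.erase w₁, u w 0 ≠ u w 1 := fun w hw => hu w (Finset.mem_of_mem_erase hw) (Finset.ne_of_mem_erase hw)
  haveI hR : ∀ (ε : {w : InfinitePlace L // IsComplex w} → Bool) (w : {w : InfinitePlace L // IsComplex w}), IsFiniteMeasureOnCompacts ((fun w : {w : InfinitePlace L // IsComplex w} =>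
          if w ∈ S.erase w₁ then (νw w).map (fun g : archLocal L 2 (Matrix.diagonal α) w =>
            g * ⟨circleDiagonal 2 (if ε w then u w ∘ ⇑(Equiv.swap (0 : Fin 2) 1) else u w), circleDiagonal_mem_archLocal_diagonal L 2 α w _⟩ * g⁻¹)
          else Measure.dirac (⟨circleDiagonal 2 ![z w, z w], circleDiagonal_mem_archLocal_diagonal L 2 α w _⟩ : archLocal L 2 (Matrix.diagonal α) w)) w) :=
    fun ε w => isFiniteMeasureOnCompacts_measureFamily L α νw z hα _ u hu' ε w
  haveI hσ : ∀ (ε : {w : InfinitePlace L // IsComplex w} → Bool) (w : {w : InfinitePlace L // IsComplex w}), SigmaFinite ((fun w : {w : InfinitePlace L // IsComplex w} =>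
          if w ∈ S.erase w₁ then (νw w).map (fun g : archLocal L 2 (Matrix.diagonal α) w =>
            g * ⟨circleDiagonal 2 (if ε w then u w ∘ ⇑(Equiv.swap (0 : Fin 2) 1) else u w), circleDiagonal_mem_archLocal_diagonal L 2 α w _⟩ * g⁻¹)
          else Measure.dirac (⟨circleDiagonal 2 ![z w, z w], circleDiagonal_mem_archLocal_diagonal L 2 α w _⟩ : archLocal L 2 (Matrix.diagonal α) w)) w) :=
    fun ε w => sigmaFinite_measureFamily L α νw z hα _ u hu' ε w
  -- the test function on `∏_w G_w`
  set F : (∀ w : {w : InfinitePlace L // IsComplex w}, archLocal L 2 (Matrix.diagonal α) w) → E := fun o => Θ (((((archPiEquivCM 2 L (Matrix.diagonal α)).symm o) : arch (↥(maximalRealSubfield L)) L (IsCMField.complexConj L) 2 (Matrix.diagonal α)) : GL (Fin 2) (mixedSpace L)) : Matrix (Fin 2) (Fin 2) (mixedSpace L)) with hF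
  obtain ⟨hFc, hFs⟩ := continuous_hasCompactSupport_comp_archPiEquivCM_symm L α Θ hΘ.continuous hΘc
  have hFm : StronglyMeasurable F := hFc.stronglyMeasurable
  -- the other-place families, blind to `ε w₁`
  set μ' : ({w : InfinitePlace L // IsComplex w} → Bool) → ∀ w' : {w : {w : InfinitePlace L // IsComplex w} // ¬ w = w₁}, Measure (archLocal L 2 (Matrix.diagonal α) w'.1) :=
    fun ε w' => (fun w : {w : InfinitePlace L // IsComplex w} =>
          if w ∈ S.erase w₁ then (νw w).map (fun g : archLocal L 2 (Matrix.diagonal α) w =>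
            g * ⟨circleDiagonal 2 (if ε w then u w ∘ ⇑(Equiv.swap (0 : Fin 2) 1) else u w), circleDiagonal_mem_archLocal_diagonal L 2 α w _⟩ * g⁻¹)
          else Measure.dirac (⟨circleDiagonal 2 ![z w, z w], circleDiagonal_mem_archLocal_diagonal L 2 α w _⟩ : archLocal L 2 (Matrix.diagonal α) w)) w'.1 with hμ'
  haveI : ∀ ε w', IsFiniteMeasureOnCompacts (μ' ε w') := fun ε w' => hR ε w'.1
  haveI : ∀ ε w', SigmaFinite (μ' ε w') := fun ε w' => hσ ε w'.1
  set g : ({w : InfinitePlace L // IsComplex w} → Bool) → ℝ → E := fun ε ψ => (2 * Real.sin ψ) •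
    ∫ k : archLocal L 2 (Matrix.diagonal α) w₁, ∫ o : (∀ w' : {w : {w : InfinitePlace L // IsComplex w} // ¬ w = w₁}, archLocal L 2 (Matrix.diagonal α) w'.1),
      Θ (((((archPiEquivCM 2 L (Matrix.diagonal α)).symm ((MeasurableEquiv.piEquivPiSubtypeProd (fun w : {w : InfinitePlace L // IsComplex w} => ↥(archLocal L 2 (Matrix.diagonal α) w)) (· = w₁)).symm
              ((MeasurableEquiv.piUnique fun i : {w : {w : InfinitePlace L // IsComplex w} // w = w₁} => ↥(archLocal L 2 (Matrix.diagonal α) i.1)).symm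
                (k * ⟨circleDiagonal 2 ![z w₁ * Circle.exp ψ, z w₁ * Circle.exp (-ψ)], circleDiagonal_mem_archLocal_diagonal L 2 α w₁ _⟩ * k⁻¹), o))) : arch (↥(maximalRealSubfield L)) L (IsCMField.complexConj L) 2 (Matrix.diagonal α)) : GL (Fin 2) (mixedSpace L)) : Matrix (Fin 2) (Fin 2) (mixedSpace L))
      ∂(Measure.pi (μ' ε)) ∂(νw w₁) with hg
  set V : ({w : InfinitePlace L // IsComplex w} → Bool) → E := fun ε =>
    ∫ o : (∀ w' : {w : {w : InfinitePlace L // IsComplex w} // ¬ w = w₁}, archLocal L 2 (Matrix.diagonal α) w'.1),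
      Θ (((((archPiEquivCM 2 L (Matrix.diagonal α)).symm ((MeasurableEquiv.piEquivPiSubtypeProd (fun w : {w : InfinitePlace L // IsComplex w} => ↥(archLocal L 2 (Matrix.diagonal α) w)) (· = w₁)).symm
              ((MeasurableEquiv.piUnique fun i : {w : {w : InfinitePlace L // IsComplex w} // w = w₁} => ↥(archLocal L 2 (Matrix.diagonal α) i.1)).symm
                ((⟨circleDiagonal 2 ![z w₁, z w₁], circleDiagonal_mem_archLocal_diagonal L 2 α w₁ _⟩ : archLocal L 2 (Matrix.diagonal α) w₁)), o))) : arch (↥(maximalRealSubfield L)) L (IsCMField.complexConj L) 2 (Matrix.diagonal α)) : GL (Fin 2) (mixedSpace L)) : Matrix (Fin 2) (Fin 2) (mixedSpace L))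
      ∂(Measure.pi (μ' ε)) with hV
  have hgl : ∀ ε, Tendsto (fun ψ : ℝ => deriv (g ε) ψ) (𝓝[≠] 0) (𝓝 (C • V ε)) ∧
      ∀ ψ ∈ Ioo (-1 : ℝ) 1, ψ ≠ 0 → DifferentiableAt ℝ (g ε) ψ := fun ε => hlim (μ' ε) Θ hΘ hΘc (z w₁)
  -- `V ε` is the Dirac-at-`w₁` integral over `M(S ∖ w₁, u, ε)`
  have hVint : ∀ ε, V ε = ∫ o, Θ (((((archPiEquivCM 2 L (Matrix.diagonal α)).symm o) : arch (↥(maximalRealSubfield L)) L (IsCMField.complexConj L) 2 (Matrix.diagonal α)) : GL (Fin 2) (mixedSpace L)) : Matrix (Fin 2) (Fin 2) (mixedSpace L))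
          ∂(Measure.pi (fun w : {w : InfinitePlace L // IsComplex w} =>
          if w ∈ S.erase w₁ then (νw w).map (fun g : archLocal L 2 (Matrix.diagonal α) w =>
            g * ⟨circleDiagonal 2 (if ε w then u w ∘ ⇑(Equiv.swap (0 : Fin 2) 1) else u w), circleDiagonal_mem_archLocal_diagonal L 2 α w _⟩ * g⁻¹)
          else Measure.dirac (⟨circleDiagonal 2 ![z w, z w], circleDiagonal_mem_archLocal_diagonal L 2 α w _⟩ : archLocal L 2 (Matrix.diagonal α) w))) := by
    intro ε
    have h1 : (∫ o, Θ (((((archPiEquivCM 2 L (Matrix.diagonal α)).symm o) : arch (↥(maximalRealSubfield L)) L (IsCMField.complexConj L) 2 (Matrix.diagonal α)) : GL (Fin 2) (mixedSpace L)) : Matrix (Fin 2) (Fin 2) (mixedSpace L))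
          ∂(Measure.pi (fun w : {w : InfinitePlace L // IsComplex w} =>
          if w ∈ S.erase w₁ then (νw w).map (fun g : archLocal L 2 (Matrix.diagonal α) w =>
            g * ⟨circleDiagonal 2 (if ε w then u w ∘ ⇑(Equiv.swap (0 : Fin 2) 1) else u w), circleDiagonal_mem_archLocal_diagonal L 2 α w _⟩ * g⁻¹)
          else Measure.dirac (⟨circleDiagonal 2 ![z w, z w], circleDiagonal_mem_archLocal_diagonal L 2 α w _⟩ : archLocal L 2 (Matrix.diagonal α) w)))) =
        ∫ o, F o ∂(Measure.pi (Function.update (fun w : {w : InfinitePlace L // IsComplex w} =>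
          if w ∈ S.erase w₁ then (νw w).map (fun g : archLocal L 2 (Matrix.diagonal α) w =>
            g * ⟨circleDiagonal 2 (if ε w then u w ∘ ⇑(Equiv.swap (0 : Fin 2) 1) else u w), circleDiagonal_mem_archLocal_diagonal L 2 α w _⟩ * g⁻¹)
          else Measure.dirac (⟨circleDiagonal 2 ![z w, z w], circleDiagonal_mem_archLocal_diagonal L 2 α w _⟩ : archLocal L 2 (Matrix.diagonal α) w)) w₁
          (Measure.dirac (⟨circleDiagonal 2 ![z w₁, z w₁], circleDiagonal_mem_archLocal_diagonal L 2 α w₁ _⟩ : archLocal L 2 (Matrix.diagonal α) w₁)))) := by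
      rw [← measureFamily_eq_update_dirac L α νw z (S.erase w₁) w₁ (Finset.notMem_erase w₁ S) u ε]
    rw [h1, integral_pi_update_dirac_archLocal L 2 α _ w₁ _ F (integrable_pi_update_of_hasCompactSupport _ w₁ _ F hFc hFs)]
  -- each term of the function, in the iterated currency: `2 sin ψ • ∫ Θ d(⊗ M(S, u_ψ, ε)) = g_ε(ψ)` or `−g_ε(−ψ)`
  have hI : ∀ ψ ∈ Ioo (-1 : ℝ) 1, ψ ≠ 0 → (2 * Real.sin ψ) • ∑ ε : {w : InfinitePlace L // IsComplex w} → Bool,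
      ∫ o, Θ (((((archPiEquivCM 2 L (Matrix.diagonal α)).symm o) : arch (↥(maximalRealSubfield L)) L (IsCMField.complexConj L) 2 (Matrix.diagonal α)) : GL (Fin 2) (mixedSpace L)) : Matrix (Fin 2) (Fin 2) (mixedSpace L))
          ∂(Measure.pi (fun w : {w : InfinitePlace L // IsComplex w} =>
          if w ∈ S then (νw w).map (fun g : archLocal L 2 (Matrix.diagonal α) w =>
            g * ⟨circleDiagonal 2 (if ε w then (Function.update u w₁ ![z w₁ * Circle.exp ψ, z w₁ * Circle.exp (-ψ)]) w ∘ ⇑(Equiv.swap (0 : Fin 2) 1) else (Function.update u w₁ ![z w₁ * Circle.exp ψ, z w₁ * Circle.exp (-ψ)]) w), circleDiagonal_mem_archLocal_diagonal L 2 α w _⟩ * g⁻¹)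
          else Measure.dirac (⟨circleDiagonal 2 ![z w, z w], circleDiagonal_mem_archLocal_diagonal L 2 α w _⟩ : archLocal L 2 (Matrix.diagonal α) w))) =
      ∑ ε : {w : InfinitePlace L // IsComplex w} → Bool, (if ε w₁ then -(g ε (-ψ)) else g ε ψ) := by
    intro ψ hψ hψ0
    rw [Finset.smul_sum]
    refine Finset.sum_congr rfl fun ε _ => ?_
    have hreg : z w₁ * Circle.exp ψ ≠ z w₁ * Circle.exp (-ψ) := mul_exp_ne_mul_exp_neg (z w₁) hψ hψ0
    have hinj : Function.Injective (if ε w₁ then ![z w₁ * Circle.exp ψ, z w₁ * Circle.exp (-ψ)] ∘ ⇑(Equiv.swap (0 : Fin 2) 1) else ![z w₁ * Circle.exp ψ, z w₁ * Circle.exp (-ψ)]) := by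
      split_ifs
      · exact injective_of_apply_zero_ne_apply_one _ (comp_swap_apply_zero_ne _ hreg)
      · exact injective_of_apply_zero_ne_apply_one _ hreg
    haveI := isFiniteMeasureOnCompacts_map_conj_circleDiagonal L 2 α w₁ hα _ hinj (νw w₁)
    haveI := sigmaFinite_map_conj_circleDiagonal L 2 α w₁ hα _ hinj (νw w₁)
    rw [measureFamily_update_eq_update L α νw z S w₁ hw₁ u _ ε,
      show (∫ o, Θ (((((archPiEquivCM 2 L (Matrix.diagonal α)).symm o) : arch (↥(maximalRealSubfield L)) L (IsCMField.complexConj L) 2 (Matrix.diagonal α)) : GL (Fin 2) (mixedSpace L)) : Matrix (Fin 2) (Fin 2) (mixedSpace L))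
        ∂(Measure.pi (Function.update (fun w : {w : InfinitePlace L // IsComplex w} =>
          if w ∈ S.erase w₁ then (νw w).map (fun g : archLocal L 2 (Matrix.diagonal α) w =>
            g * ⟨circleDiagonal 2 (if ε w then u w ∘ ⇑(Equiv.swap (0 : Fin 2) 1) else u w), circleDiagonal_mem_archLocal_diagonal L 2 α w _⟩ * g⁻¹)
          else Measure.dirac (⟨circleDiagonal 2 ![z w, z w], circleDiagonal_mem_archLocal_diagonal L 2 α w _⟩ : archLocal L 2 (Matrix.diagonal α) w)) w₁
          ((νw w₁).map (fun g : archLocal L 2 (Matrix.diagonal α) w₁ =>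
            g * ⟨circleDiagonal 2 (if ε w₁ then ![z w₁ * Circle.exp ψ, z w₁ * Circle.exp (-ψ)] ∘ ⇑(Equiv.swap (0 : Fin 2) 1) else ![z w₁ * Circle.exp ψ, z w₁ * Circle.exp (-ψ)]),
              circleDiagonal_mem_archLocal_diagonal L 2 α w₁ _⟩ * g⁻¹))))) = ∫ o, F o ∂_ from rfl,
      integral_pi_update_map_conj_circleDiagonal_archLocal L 2 α _ w₁ _ (νw w₁) F hFm
        (integrable_pi_update_of_hasCompactSupport _ w₁ _ F hFc hFs)]
    cases hb : ε w₁
    · simp only [Bool.false_eq_true, ↓reduceIte, hg, hF, hμ']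
    · simp only [↓reduceIte, hg, hF, hμ', comp_swap_eq, Real.sin_neg, mul_neg, neg_smul, neg_neg]
  -- the flipped terms are differentiable on `0 < |ψ| < 1` with the symmetric derivative
  have hderivG : ∀ ψ ∈ Ioo (-1 : ℝ) 1, ψ ≠ 0 →
      HasDerivAt (fun ψ : ℝ => ∑ ε : {w : InfinitePlace L // IsComplex w} → Bool, (if ε w₁ then -(g ε (-ψ)) else g ε ψ))
        (∑ ε : {w : InfinitePlace L // IsComplex w} → Bool, (if ε w₁ then deriv (g ε) (-ψ) else deriv (g ε) ψ)) ψ := by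
    intro ψ hψ hψ0
    have hneg : -ψ ∈ Ioo (-1 : ℝ) 1 := by
      simp only [mem_Ioo] at hψ ⊢
      constructor <;> linarith [hψ.1, hψ.2]
    have hψ0' : -ψ ≠ 0 := neg_ne_zero.2 hψ0
    refine HasDerivAt.fun_sum fun ε _ => ?_
    cases hb : ε w₁
    · simp only [Bool.false_eq_true, ↓reduceIte]
      exact ((hgl ε).2 ψ hψ hψ0).hasDerivAt
    · simp only [↓reduceIte]
      have hg1 : HasDerivAt (g ε) (deriv (g ε) (-ψ)) (-ψ) := ((hgl ε).2 (-ψ) hneg hψ0').hasDerivAt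
      have h2 : HasDerivAt (fun ψ : ℝ => g ε (-ψ)) ((-1 : ℝ) • deriv (g ε) (-ψ)) ψ := hg1.scomp ψ (hasDerivAt_neg ψ)
      have h3 := h2.neg
      simp only [neg_smul, one_smul, neg_neg] at h3
      exact h3
  -- the open punctured window and the identification of the function there
  have hIoo : ∀ᶠ ψ : ℝ in 𝓝[≠] 0, ψ ∈ Ioo (-1 : ℝ) 1 ∧ ψ ≠ 0 :=
    Filter.inter_mem (mem_nhdsWithin_of_mem_nhds (Ioo_mem_nhds (by norm_num) (by norm_num))) self_mem_nhdsWithin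
  have hopen : IsOpen (Ioo (-1 : ℝ) 1 ∩ {(0 : ℝ)}ᶜ) := isOpen_Ioo.inter isOpen_compl_singleton
  have hlocal : ∀ ψ ∈ Ioo (-1 : ℝ) 1, ψ ≠ 0 → (fun ψ : ℝ => (2 * Real.sin ψ) • ∑ ε : {w : InfinitePlace L // IsComplex w} → Bool,
      ∫ o, Θ (((((archPiEquivCM 2 L (Matrix.diagonal α)).symm o) : arch (↥(maximalRealSubfield L)) L (IsCMField.complexConj L) 2 (Matrix.diagonal α)) : GL (Fin 2) (mixedSpace L)) : Matrix (Fin 2) (Fin 2) (mixedSpace L))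
          ∂(Measure.pi (fun w : {w : InfinitePlace L // IsComplex w} =>
          if w ∈ S then (νw w).map (fun g : archLocal L 2 (Matrix.diagonal α) w =>
            g * ⟨circleDiagonal 2 (if ε w then (Function.update u w₁ ![z w₁ * Circle.exp ψ, z w₁ * Circle.exp (-ψ)]) w ∘ ⇑(Equiv.swap (0 : Fin 2) 1) else (Function.update u w₁ ![z w₁ * Circle.exp ψ, z w₁ * Circle.exp (-ψ)]) w), circleDiagonal_mem_archLocal_diagonal L 2 α w _⟩ * g⁻¹)
          else Measure.dirac (⟨circleDiagonal 2 ![z w, z w], circleDiagonal_mem_archLocal_diagonal L 2 α w _⟩ : archLocal L 2 (Matrix.diagonal α) w)))) =ᶠ[𝓝 ψ]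
      (fun ψ : ℝ => ∑ ε : {w : InfinitePlace L // IsComplex w} → Bool, (if ε w₁ then -(g ε (-ψ)) else g ε ψ)) := by
    intro ψ hψ hψ0
    filter_upwards [hopen.mem_nhds ⟨hψ, hψ0⟩] with y hy
    exact hI y hy.1 hy.2
  refine ⟨fun ψ hψ hψ0 => ((hlocal ψ hψ hψ0).differentiableAt_iff).2 (hderivG ψ hψ hψ0).differentiableAt, ?_⟩
  -- the derivative on the punctured window, and its limit
  have hderiv_eq : (fun ψ : ℝ => deriv (fun ψ : ℝ => (2 * Real.sin ψ) • ∑ ε : {w : InfinitePlace L // IsComplex w} → Bool,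
      ∫ o, Θ (((((archPiEquivCM 2 L (Matrix.diagonal α)).symm o) : arch (↥(maximalRealSubfield L)) L (IsCMField.complexConj L) 2 (Matrix.diagonal α)) : GL (Fin 2) (mixedSpace L)) : Matrix (Fin 2) (Fin 2) (mixedSpace L))
          ∂(Measure.pi (fun w : {w : InfinitePlace L // IsComplex w} =>
          if w ∈ S then (νw w).map (fun g : archLocal L 2 (Matrix.diagonal α) w =>
            g * ⟨circleDiagonal 2 (if ε w then (Function.update u w₁ ![z w₁ * Circle.exp ψ, z w₁ * Circle.exp (-ψ)]) w ∘ ⇑(Equiv.swap (0 : Fin 2) 1) else (Function.update u w₁ ![z w₁ * Circle.exp ψ, z w₁ * Circle.exp (-ψ)]) w), circleDiagonal_mem_archLocal_diagonal L 2 α w _⟩ * g⁻¹)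
          else Measure.dirac (⟨circleDiagonal 2 ![z w, z w], circleDiagonal_mem_archLocal_diagonal L 2 α w _⟩ : archLocal L 2 (Matrix.diagonal α) w)))) ψ) =ᶠ[𝓝[≠] (0 : ℝ)]
      fun ψ : ℝ => ∑ ε : {w : InfinitePlace L // IsComplex w} → Bool, (if ε w₁ then deriv (g ε) (-ψ) else deriv (g ε) ψ) := by
    filter_upwards [hIoo] with ψ hψ
    rw [(hlocal ψ hψ.1 hψ.2).deriv_eq, (hderivG ψ hψ.1 hψ.2).deriv]
  rw [Filter.tendsto_congr' hderiv_eq]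
  have hsumV : C • ∑ ε : {w : InfinitePlace L // IsComplex w} → Bool,
      ∫ o, Θ (((((archPiEquivCM 2 L (Matrix.diagonal α)).symm o) : arch (↥(maximalRealSubfield L)) L (IsCMField.complexConj L) 2 (Matrix.diagonal α)) : GL (Fin 2) (mixedSpace L)) : Matrix (Fin 2) (Fin 2) (mixedSpace L))
          ∂(Measure.pi (fun w : {w : InfinitePlace L // IsComplex w} =>
          if w ∈ S.erase w₁ then (νw w).map (fun g : archLocal L 2 (Matrix.diagonal α) w =>
            g * ⟨circleDiagonal 2 (if ε w then u w ∘ ⇑(Equiv.swap (0 : Fin 2) 1) else u w), circleDiagonal_mem_archLocal_diagonal L 2 α w _⟩ * g⁻¹)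
          else Measure.dirac (⟨circleDiagonal 2 ![z w, z w], circleDiagonal_mem_archLocal_diagonal L 2 α w _⟩ : archLocal L 2 (Matrix.diagonal α) w))) =
      ∑ ε : {w : InfinitePlace L // IsComplex w} → Bool, C • V ε := by
    rw [Finset.smul_sum]
    exact Finset.sum_congr rfl fun ε _ => by rw [hVint ε]
  rw [hsumV]
  refine tendsto_finsetSum _ fun ε _ => ?_
  cases hb : ε w₁
  · simp only [Bool.false_eq_true, ↓reduceIte]
    exact (hgl ε).1
  · simp only [↓reduceIte]
    exact (hgl ε).1.comp tendsto_neg_nhdsWithin_ne_zero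

open scoped Classical in
/-- **THE H-SIDE ONE-STEP LAW AT EVERY PLACE, ONE FAMILY OF CONSTANTS** (K2E4-p09's «V1+» binder shape, 2026-09-03T21:20:04Z): `∃ C : W → ℝ`, all `≠ 0`, such that for every smooth compactly
supported `Θ`, every `S ∋ w₁` and every `u` regular on `S ∖ w₁`, `∂_ψ[2 sin ψ • I(S, u[w₁ ↦ (z e^{iψ}, z e^{−iψ})])] → C_{w₁} • I(S ∖ w₁, u)` along `𝓝[≠] 0` — the `hstep` of ★
`K2E4ArchSingularKernelPlaceInduction.eq_of_step_of_regular_eq` for the H-state family `A S u := κ • (∏_{w ∈ S} C_w) • I(univ ∖ S, u)` of the #9 assembly.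
[cite: Rogawski1990, §8.2 Prop. 8.2.1 pp. 118–119; §14.5 Lemma 14.5.2 (b)(c) p. 238] [cite: Varadarajan1989, §6.4 Thm. 22] -/
theorem exists_const_forall_tendsto_deriv_two_sin_smul_sum_integral_pi {E : Type*} [NormedAddCommGroup E] [NormedSpace ℝ E] [CompleteSpace E]
    (hα : ∀ i, α i ≠ 0)
    (hreal : ∀ (w : {w : InfinitePlace L // IsComplex w}) (i : Fin 2), (w.1.embedding (α i)).im = 0)
    (hsgn : ∀ w : {w : InfinitePlace L // IsComplex w}, (w.1.embedding (α 0)).re * (w.1.embedding (α 1)).re < 0) :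
    ∃ C : {w : InfinitePlace L // IsComplex w} → ℝ, (∀ w, C w ≠ 0) ∧
      ∀ (Θ : Matrix (Fin 2) (Fin 2) (mixedSpace L) → E), ContDiff ℝ (⊤ : ℕ∞) Θ →
        HasCompactSupport (fun g : arch (↥(maximalRealSubfield L)) L (IsCMField.complexConj L) 2 (Matrix.diagonal α) =>
          Θ ((g : GL (Fin 2) (mixedSpace L)) : Matrix (Fin 2) (Fin 2) (mixedSpace L))) →
        ∀ (S : Finset {w : InfinitePlace L // IsComplex w}) (w₁ : {w : InfinitePlace L // IsComplex w}), w₁ ∈ S →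
        ∀ (u : {w : InfinitePlace L // IsComplex w} → Fin 2 → Circle), (∀ w ∈ S, w ≠ w₁ → u w 0 ≠ u w 1) →
        Tendsto (fun ψ : ℝ => deriv (fun ψ : ℝ => (2 * Real.sin ψ) • ∑ ε : {w : InfinitePlace L // IsComplex w} → Bool,
          ∫ o, Θ (((((archPiEquivCM 2 L (Matrix.diagonal α)).symm o) : arch (↥(maximalRealSubfield L)) L (IsCMField.complexConj L) 2 (Matrix.diagonal α)) : GL (Fin 2) (mixedSpace L)) : Matrix (Fin 2) (Fin 2) (mixedSpace L))
              ∂(Measure.pi (fun w : {w : InfinitePlace L // IsComplex w} =>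
              if w ∈ S then (νw w).map (fun g : archLocal L 2 (Matrix.diagonal α) w =>
                g * ⟨circleDiagonal 2 (if ε w then (Function.update u w₁ ![z w₁ * Circle.exp ψ, z w₁ * Circle.exp (-ψ)]) w ∘ ⇑(Equiv.swap (0 : Fin 2) 1) else (Function.update u w₁ ![z w₁ * Circle.exp ψ, z w₁ * Circle.exp (-ψ)]) w), circleDiagonal_mem_archLocal_diagonal L 2 α w _⟩ * g⁻¹)
              else Measure.dirac (⟨circleDiagonal 2 ![z w, z w], circleDiagonal_mem_archLocal_diagonal L 2 α w _⟩ : archLocal L 2 (Matrix.diagonal α) w)))) ψ)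
          (𝓝[≠] 0)
          (𝓝 (C w₁ • ∑ ε : {w : InfinitePlace L // IsComplex w} → Bool,
            ∫ o, Θ (((((archPiEquivCM 2 L (Matrix.diagonal α)).symm o) : arch (↥(maximalRealSubfield L)) L (IsCMField.complexConj L) 2 (Matrix.diagonal α)) : GL (Fin 2) (mixedSpace L)) : Matrix (Fin 2) (Fin 2) (mixedSpace L))
              ∂(Measure.pi (fun w : {w : InfinitePlace L // IsComplex w} =>
              if w ∈ S.erase w₁ then (νw w).map (fun g : archLocal L 2 (Matrix.diagonal α) w =>
                g * ⟨circleDiagonal 2 (if ε w then u w ∘ ⇑(Equiv.swap (0 : Fin 2) 1) else u w), circleDiagonal_mem_archLocal_diagonal L 2 α w _⟩ * g⁻¹)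
              else Measure.dirac (⟨circleDiagonal 2 ![z w, z w], circleDiagonal_mem_archLocal_diagonal L 2 α w _⟩ : archLocal L 2 (Matrix.diagonal α) w))))) := by
  have hstep := fun w₁ : {w : InfinitePlace L // IsComplex w} =>
    exists_const_tendsto_deriv_two_sin_smul_sum_integral_pi (E := E) L α νw z hα w₁ (hreal w₁) (hsgn w₁)
  choose C hC hS using hstep
  exact ⟨C, hC, fun Θ hΘ hΘc S w₁ hw₁ u hu => (hS w₁ Θ hΘ hΘc S hw₁ u hu).2⟩

end StepLaw

end Literature.NumberTheory.Automorphic.UnitaryGroup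

end
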